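import Summits.HodgeConjecture.HodgeConjecture.Theses.CYFormCasimir
import Summits.HodgeConjecture.HodgeConjecture.Theorems.CYFormCasimirCYFormCarrierEightTransportReduction
import Summits.HodgeConjecture.HodgeConjecture.Theorems.CYFormCasimirCYFormCarrierEightCYForm
import Literature.AlgebraicGeometry.HodgeTheory.WeilClassesFourfoldsProofs
import Literature.AlgebraicGeometry.HodgeTheory.CorrespondenceActionOfGraph
import Literature.AlgebraicGeometry.Motives.AbelianVarietyProductDimProofs
import Literature.NumberTheory.EllipticCurves.CMEndomorphismOfMulMemLattice
import Literature.AlgebraicGeometry.HodgeTheory.WeilClassesTwistedSquare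
import Literature.AlgebraicGeometry.HodgeTheory.ComplexOrientationFamily
import Literature.AlgebraicGeometry.HodgeTheory.EllipticCurvePowersHodgeClasses
import HarnessLib
import HarnessLib.Audit

/-!
# Line `birth` (BC3 skeleton + BC5 rung) — crux `CYFormCasimir.CYFormCorrCarrierEight` (X1corr)
# (item stmt-HodgeConjecture-26946, route route-HodgeConjecture-CYFormCasimir rev 4 5e9f8d3c7cdd (items added rev 3 d4cb61350496, glue sha16 d334a77172ff7147)) — **v5: v4 re-pointed after the
# route edit R13.15 (correspondence-carrier pivot X1 ↦ X1corr, X2 ↦ X2corr)**: STUB 2 is now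
# `stub_corrCarrier_of_cyform : CorrCarrierOfCYFormEight` and the composition `CYFormCorrCarrierEight_of_stubs`
# concludes the route decl `CYFormCasimir.CYFormCorrCarrierEight` BY NAME; the rung
# `stub_correspondenceCarrier_at_CM_point` (v4) is verbatim (planner hodge-idea-2 g4, 2026-08-28; director
# R12.15 / R13.15; inputs: `RUNG-transport-nogo.md` 083faca84523 §pivot, J-NOGO cup-square rank 3d2655686e17e044,
# v4 08854a709a09).  v5.1 (hodge-cyf-w-1 g1, 2026-08-28, post-edit step): `CYFormCorrCarrierEight_of` now concludes
# the UNFOLDED statement and `CYFormCorrCarrierEight_of_stubs` is the UNIQUE theorem concluding the route constant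
# (skeleton-audit determinism; stubs, rung and every signature a prover `--supports` are byte-identical to v5 990698f8e89b)
# v5.2 (tribunal-w hodge-trib-w-cyf g0, 2026-08-28; J ROUND 2 fb38ea6ef7abd5a4 (T3) grant condition F2(α)): APPEND-ONLY —
# §5 adds STUB 4 `stub_corrCarrier_at_weilFourfoldProduct`, the PLAN-ONLY rung on PRODUCTS `A = X × X′` of two Hodge-general
# split ℚ(√-d)-Weil FOURFOLDS (X1corr's ∃-conclusion verbatim at `(X.prod X′, φ × φ′)`; E8 there is print-known, NOT a tree
# theorem), its n = 2 shadow clause `K3FormCorrCarrierFour` (vG–R 2026 K3^[3] carriers, a `def`, not a stub) and sorry-free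
# packaging; every v5.1 declaration (names, signatures, proofs) is byte-identical, so `--supports` work in flight is unaffected.
# v5.3 (tribunal-w hodge-trib-w-cyf g2, 2026-08-28; same J r2 F2(α) grant, «modulo print-known regime»): APPEND-ONLY — §6 adds STUB 5
# `stub_corrCarrier_at_weilFourfoldTwistedSquare`, the (α)-regime rung CLOSEST TO THE KERNEL: the twisted square `A = (X × X, φ × (−φ))` of ONE
# Hodge-general Weil fourfold, with its CY half PROVED sorry-free for every fourfold (`isCYFormAt_cyFormTwSq`), the carrier `Y = X`, `T_Y = H⁴(X)`,
# `γ` = a ℚ-combination of transposed graphs, the kernel-checked reduction to (R1) generic push–pull + (R2) the Deligne identity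
# `T₀ = (Π₊+Π₋) m_Σ^* H⁴(X)` + (R3) the square clause at `Y = X` (⟺ E4(X): print-known, not tree-known), the tree citation that the two Weil
# lines of the twisted square are algebraic (`weilClasses_twSq_algebraic`), and an ERRATUM to STUB 4's clause (i) (Künneth ranks of the ℚ-form are
# (2,32,36), not (1,16,36,16,1)); one new import (`WeilClassesTwistedSquare`); every v5.2 declaration is byte-identical.
# v5.4 (tribunal-w hodge-trib-w-cyf g3, 2026-08-28; J ROUND 2 fb38ea6ef7abd5a4 / r2a 9901642a248eb9f5: STUB 3 = the registered rung, inside the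
# TREE-known regime): STUB 3 `stub_correspondenceCarrier_at_CM_point` is PROVED SORRY-FREE — its `sorry` is replaced by the term
# `correspondenceCarrier_at_CM_point_rung` of the new §1b «TRIVIAL (self-)correspondence carrier»: `Y = P.X`, `m = dim P`, `T_Y = T₀ = cyFormAnchor`,
# `γ = [Δ_P] = (𝟙,𝟙)₊1` (algebraic, acts as `id` up to a non-zero scalar: `exists_algebraic_corrAction_eq_of_pushPull`,
# `corrAction_eq_smul_of_orientationFamily`), square clause = HC⁴ for `P × P ≅ E₀¹⁶`, a TREE theorem for every elliptic curve
# (`EllSlots.hodgeConjectureFor'`, `AbelianVariety.dim_prod`).  Two new imports (`ComplexOrientationFamily`, `EllipticCurvePowersHodgeClasses`); STUB 3's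
# name and statement and EVERY other v5.3 declaration (names, signatures, proofs) are byte-identical, so `--supports` work in flight (R1/R2/R3 of §3,
# the NON-trivial `Y = E₀⁴` carrier) is unaffected and keeps its value as transport infrastructure for X2corr.  Sorried stubs 4 → 3.  The T3 chip is
# UNCHANGED (plan-only on STUB 4 / STUB 5; the proved rung is width 0 toward H2, exactly as J booked it).  STRUCTURAL REMARK (§1b docstring): AS TYPED,
# `HasCorrCarrier A T` admits the self-carrier whenever the rational (4,4)-classes of `T ⊠ T ⊂ H⁸(A × A)` are algebraic — recorded for J / the director.

HONEST FRAMING. Nothing in this file proves X1, the route, rung H2 (`SevenfoldWeilCensus.WeilSixfolds`), HC for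
abelian varieties or the Hodge conjecture; the route stays a research route CONDITIONAL in spirit on finding a
carrier (HC_CM HELD elsewhere is not used or advanced here). EXACTLY THREE statements are SORRIED STUBS (v5.4; four in v5.3, three in v5.2, two in v5.1)
(`stub_corrCarrier_of_cyform` — LOAD-BEARING binder 2 of `CYFormCorrCarrierEight_of` —
and — v5.2, §5 — the F2(α) rung `stub_corrCarrier_at_weilFourfoldProduct`
on products of Weil-type fourfolds, PLAN-ONLY, NOT a binder of the composition either; and — v5.3, §6 — STUB 5
`stub_corrCarrier_at_weilFourfoldTwistedSquare` on twisted squares `X × X̄`, CY half PROVED, NOT a binder of the composition); the rung STUB 3 `stub_correspondenceCarrier_at_CM_point` (verbatim v4) is PROVED in this file (v5.4, §1b, trivial self-carrier); binder 1 `stub_cyform_exists` is PROVED in tree (p611494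
`Theorems.CYFormCarrier.cyFormExists_eight`, folded in per director R13.23 (3b)); everything else is packaging PROVED here.

## What changed from v3 (b57ce6a2778e, hodge-cyf-w-1 g0) and why
v3's rung `stub_carrier_at_CM_point` asked for a CLAUSE-EXACT carrier (`W ↠ P`, `f : W → Y`, `f^*T_Y = p^*T₀`) at
the CM anchor `P = S_d⁴` and NAMED the candidate `Y = E₀⁴` (`m = 4`).  J-NOGO (tribunal-j r1a, cup-square rank):
`f^*` is a RING map, so `dim span(T₀·T₀) = dim span(T_Y·T_Y) ≤ b₈(Y)`, while at the anchor
`dim span(T₀·T₀) ≥ dim Sym²-image = C(71,2) = 2485`; hence every clause-exact carrier needs `b₈(Y) ≥ 2485`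
(so `m ≥ 5`, indeed `m ≥ 8` for `T_Y·T_Y` to sit in middle degree) and `T_Y` not generated by `H¹(Y)` — the
named `m = 4` candidate is DEAD and `Theorems/…TransportReduction.carrier_at_CM_point_of_transport` is vacuous.
The route header's KILL CRITERIA name the pivot: «weaken the carrier to a correspondence-carrier (`T_Y ≅ T`
induced by an algebraic class on `Y × A`), which still feeds X3 via the same Casimir».  v4 TYPES that pivot:
* `HasCorrCarrier A T` (§0): a smooth projective `Y` (dim `m`), `T_Y ⊂ H⁴(Y)` (`dim 70`, rational- and
  pure-type-spanned), an ALGEBRAIC class `γ ∈ Alg^m(A.X ⊗ Y)` whose action `γ_* = pr_{A*}(pr_Y^*(–) ∪ γ)` (the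
  tree's REAL `corrAction μ`, `ComplexGysinCorrespondence`) maps `T_Y` onto `T` for every orientation family `μ`
  with Poincaré duality (orientation-free: `corrAction_eq_smul_of_orientationFamily`), and the SQUARE CLAUSE moved
  to `Y × Y`: every rational `(4,4)`-class in `span(pr₁^*T_Y ∪ pr₂^*T_Y) ⊂ H⁸(Y ⊗ Y)` is algebraic (this is what
  the Casimir transport `κ = δ_A^*((γ ⊠ γ)_* c_Y)` consumes; the v3 clause `T_Y ⊔ Alg²(Y) = ⊤` is NOT needed by a
  correspondence transport and is dropped).  J-NOGO does NOT constrain correspondence carriers: `γ_*` is not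
  multiplicative, so `b₈(Y) ≥ 2485` is void and `m = 4` is admissible again.
* THE RUNG `stub_correspondenceCarrier_at_CM_point` (§2) — booked «infrastructure rung, width 0 toward H2» (idea-crit-6
  PWP 2026-08-28T07:56:48Z: at the anchor the ambient HC(E₀¹²) is in tree, so the rung certifies the additive-transport
  plumbing R1/R2/R3 and the CY-form half, not the open price) = the ∃-conclusion of the pivoted X1 (`X1corr`, §4)
  VERBATIM at the named anchor: `∃ T, IsCYFormAt d P ψ T ∧ HasCorrCarrier P T`, for every `d > 0` and every CM
  datum `(E₀, ψ₀)`.  NAMED CM POINT: `P = pad4Anchor E₀ = S⁴`, `S = E₀ × E₀`, `ψ = (ψ₀ × (−ψ₀))⁴`, any CM curve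
  `ψ₀² = -d` (`exists_anchor`).  NAMED CARRIER: `Y = pad2Anchor E₀ = S² ≅ E₀⁴` (abelian fourfold, `m = 4`,
  `T_Y = H⁴(Y) = ⊤`, Hodge numbers `(1,16,36,16,1)` = those of `T₀`), `T₀ = cyFormAnchor = (𝟙 + σ^*)(⋀⁴W^*)`
  (landed: `Theorems.CYFormCarrier.isCYForm_fixedForm_pad4Anchor`, p600857), and the EXPLICIT correspondence
  (§3, `GraphSumTransportAt`): `γ = Σ_{j=0}^{4} β_j ( [Γᵗ_{g_j}] + [Γᵗ_{σ ≫ g_j}] )`, `g_j = (n·𝟙 + ψ)^j ≫ m_Σ`,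
  `m_Σ : S⁴ → E₀⁴` the coordinatewise sum `(x_j, y_j) ↦ x_j + y_j`, `n = d + 1`, `β_j ∈ ℚ(√-d)` the Lagrange
  coefficients of the projector onto `⋀⁴V₋` — because `Π₋ ∘ m_Σ^* = ⋀⁴(q_y^*π^{1,0} + q_x^*π^{0,1})` is an
  isomorphism `H⁴(E₀⁴) → ⋀⁴V₋` and `(𝟙 + σ^*)⋀⁴V₋ = T₀`.  So at the CM point the rung is PROVABLE from tree tools
  (push–pull `corrAction_gysinGraph_one` ported to two factors, `gysinGraph_one_mem_algebraicClasses`, the pencil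
  calculus of `AbelianVarietyCohomologyExteriorH1`, and HC for `E₀⁸` = `vanGeemen1994_thm43_hodgeConjectureFor`
  for the square clause on `Y ⊗ Y ≅ E₀⁸`): reduction `stub_correspondenceCarrier_at_CM_point_of_clauses` (§3,
  kernel-checked) from three named clauses `GraphPullbackIsCorrAt`, `GraphSumTransportAt`, `SquareClauseAt`.
* v3's clause-exact rung is RETIRED from the stub list (kept as the sorry-free statement `ClauseExactRungAt` with
  the J-NOGO constraints recorded); `stub_transport_at_CM_point` (m = 4 transport) is NOT typed — it is refuted.
* §4 PIVOT PREVIEW (defs + a kernel-checked deciding theorem, NOT route items; the route is NOT edited by this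
  file): `CYFormCorrCarrierEight` (X1corr), `CasimirCorrTransportEight` (X2corr) and
  `closes_corr_preview : X1corr → X2corr → X3 → X4′ → ReachHyperbolic → WeilSixfolds` (same proof shape as the
  route's `closes`; X3 = `CYFormSquarePrinciple` CLOSED p596103 and X4′/X5 are untouched).  Under the pivot the
  TEXT OF X2 MUST CHANGE (its hypotheses are X1's carrier data) — recorded for the director (WAKE-J round 2).

T3 reading (why the rung is a witness and not inside H2's known regime): H2's proved cell is split SIXFOLDS
(`Markman2025_weilClasses_algebraic_hyperbolicSixfold`); the rung lives on an EIGHTFOLD and asserts a TRANSPORT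
statement (`γ_*H⁴(E₀⁴) = T₀` for an algebraic `γ`) that no algebraicity theorem states; HC for `E₀⁸`, `E₀¹²` is
classical and is exactly why the rung is decidable here; it exercises the lever (CY form + correspondence carrier ⇒
Casimir transport) at the route header's cheapest-falsifier point, and `T₀` is NOT a pullback class (exterior-
algebra no-go, RUNG-transport-nogo §1), so the rung forces a genuinely non-graph correspondence.

## Disproof / negatives used
No `Cruxes/CYFormCarrierEight/Disproof.lean`.  `ledger negatives --problem HodgeConjecture`: none on CY forms /
carriers / weight-4 Weil type.  Dead lines honoured: clause-exact `m = 4` carriers (J-NOGO), abelian/homomorphism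
carriers (exterior-algebra no-go), finite-quotient and curve-product covers (RUNG-transport-nogo §2–3), Dolgachev
`2n+2` double covers (SXZ Thm 1.2/1.3), Cynk–Hulek `X₄` (h^{3,1} = 4 ≠ 16) — none is the named carrier.

## References
[cite: arXiv:1109.5632, §2.4.2 p.14; Prop. 37] [cite: arXiv:math/0008076, Thm. 3.10] [cite: arXiv:2607.18341, §1.15]
[cite: vanGeemen1994HodgeAV, Thm. 4.3, 5.2–5.4, 6.12] [cite: Fulton1998, §16.1 Prop. 16.1.1–16.1.2]
[cite: VoisinHodgeII2003, proof of Thm. 10.17 (10.7)] [cite: Schoen1998HodgeWeilAddendum, §10]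
[cite: MoonenZarhin1999LowDim, Cor. (3.9)] [cite: Markman2025SurveySecant, §11.5]
-/

noncomputable section

-- single-problem summit (Problem = Summit): the mandated namespace repeats `HodgeConjecture`.
set_option linter.dupNamespace false

open CategoryTheory AlgebraicGeometry MonoidalCategory
open Literature.AlgebraicGeometry Literature.AlgebraicGeometry.Motives Literature.AlgebraicGeometry.HodgeTheory
open Literature.AlgebraicTopology.SingularHomology

namespace Summit.HodgeConjecture.HodgeConjecture.Cruxes.CYFormCorrCarrierEight.Birth

/-! ## §0 The clause bundles of X1, NAMED (verbatim the route text; `cyFormCarrierEight_iff` checks the copy) -/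

/-- The symmetrised hyperplane class `h_K(d, e, a) = d·ι^*a + φ^*ι^*a` (the literal shape in the route decls). -/
abbrev symH (d : ℕ) {A : AbelianVariety ℂ} (φ : A ⟶ A) (e : ProjectiveEmbedding A.X)
    (a : complexBetti (projectiveSpace e.n ℂ) 2) : complexBetti A.X 2 :=
  (d : ℂ) • complexBetti.map e.ι 2 a + complexBetti.map φ.hom.hom.hom 2 (complexBetti.map e.ι 2 a)

/-- **`IsCYFormAt d A φ T`** — the five `T`-clauses of X1: `T ⊂ ⋀⁴V₊ ⊕ ⋀⁴V₋` (the `(x ± y i√d)⁴`-eigenclasses),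
`T ∩ ⋀⁴V₊ = 0`, `dim T = 70`, `T` spanned by its rational classes and by its pure-type classes.
[cite: arXiv:1109.5632, §2.4.2 and Prop. 37] -/
def IsCYFormAt (d : ℕ) (A : AbelianVariety ℂ) (φ : A ⟶ A) (T : Submodule ℂ (complexBetti A.X (2 * 2))) : Prop :=
  T ≤ Literature.AlgebraicGeometry.HodgeTheory.pullbackEigenclasses A φ (2 * 2) (fun x y => ((x : ℂ) + (y : ℂ) * Complex.I * (Real.sqrt d : ℂ)) ^ 4) ⊔ Literature.AlgebraicGeometry.HodgeTheory.pullbackEigenclasses A φ (2 * 2) (fun x y => ((x : ℂ) - (y : ℂ) * Complex.I * (Real.sqrt d : ℂ)) ^ 4) ∧ T ⊓ Literature.AlgebraicGeometry.HodgeTheory.pullbackEigenclasses A φ (2 * 2) (fun x y => ((x : ℂ) + (y : ℂ) * Complex.I * (Real.sqrt d : ℂ)) ^ 4) = ⊥ ∧ Module.finrank ℂ T = 70 ∧ T ≤ Submodule.span ℂ {c | c ∈ T ∧ Literature.AlgebraicGeometry.HodgeTheory.IsRationalClass c} ∧ T ≤ Submodule.span ℂ {c | c ∈ T ∧ ∃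 p q : ℕ, p + q = 4 ∧ Literature.AlgebraicGeometry.HodgeTheory.IsOfHodgeType (2 * 4) A.X (2 * 2) p q c}

/-- **`HasCarrier A T`** (X1 AS TYPED, clause-exact) — a smooth projective `Y` (dim `m`), `T_Y ⊂ H⁴(Y)` of dim 70
spanned by rational and by pure-type classes with `T_Y ⊔ Alg²(Y) = ⊤`, every rational `(4,4)`-class of
`span(T_Y·T_Y)` algebraic, and a smooth projective eightfold `W`, `p : W ↠ A.X`, `f : W → Y` with `f^*T_Y = p^*T`.
[cite: arXiv:2607.18341, §1.15] [cite: arXiv:1109.5632, p.4] -/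
def HasCarrier (A : AbelianVariety ℂ) (T : Submodule ℂ (complexBetti A.X (2 * 2))) : Prop :=
  ∃ (m : ℕ) (Y : Literature.AlgebraicGeometry.Motives.SchemeOver ℂ) (_ : Literature.AlgebraicGeometry.Motives.IsSmoothProjective m Y) (TY : Submodule ℂ (Literature.AlgebraicGeometry.HodgeTheory.complexBetti Y (2 * 2))) (W : Literature.AlgebraicGeometry.Motives.SchemeOver ℂ) (_ : Literature.AlgebraicGeometry.Motives.IsSmoothProjective (2 * 4) W) (p : W ⟶ A.X) (_ : AlgebraicGeometry.Surjective p.left) (f : W ⟶ Y), Module.finrank ℂ TY = 70 ∧ TY ≤ Submodule.span ℂ {c | c ∈ TY ∧ Literature.AlgebraicGeometry.HodgeTheory.IsRationalClass c} ∧ TY ≤ Submodule.span ℂ {c | c ∈ TY ∧ ∃ p q : ℕ, p + q = 4 ∧ Literature.AlgebraicGeometry.HodgeTheory.IsOfHodgeType m Y (2 * 2) p q c} ∧ TY ⊔ Literature.AlgebraicGeometry.HodgeTheory.algebraicClasses Y 2 = ⊤ ∧ (∀ c ∈ Submodule.span ℂ {x | ∃ u ∈ TY, ∃ v ∈ TY,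 x = Literature.AlgebraicTopology.SingularHomology.cupProduct (show 2 * 2 + 2 * 2 = 2 * 4 from rfl) u v}, Literature.AlgebraicGeometry.HodgeTheory.IsRationalClass c → Literature.AlgebraicGeometry.HodgeTheory.IsOfHodgeType m Y (2 * 4) 4 4 c → c ∈ Literature.AlgebraicGeometry.HodgeTheory.algebraicClasses Y 4) ∧ TY.map (Literature.AlgebraicGeometry.HodgeTheory.complexBetti.map f (2 * 2)).hom = T.map (Literature.AlgebraicGeometry.HodgeTheory.complexBetti.map p (2 * 2)).hom

/-- **`HasCorrCarrier A T`** — THE CORRESPONDENCE-CARRIER BLOCK (v4 pivot of `HasCarrier`, route KILL CRITERIA):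
a smooth projective `Y` of dimension `m`, a 70-dimensional `T_Y ⊂ H⁴(Y)` spanned by rational and by pure-type
classes, the SQUARE CLAUSE ON `Y × Y` (every rational `(4,4)`-class of `span(pr₁^*T_Y ∪ pr₂^*T_Y) ⊂ H⁸(Y ⊗ Y)`
is algebraic), and an ALGEBRAIC class `γ ∈ Alg^m(A.X ⊗ Y)` (codimension `dim Y`, like a transposed graph) whose
action `γ_* = pr_{A*}(pr_Y^* – ∪ γ)` (`corrAction μ`, first factor receives) maps `T_Y` ONTO `T`, for every
orientation family `μ` with Poincaré duality (orientation-free up to a non-zero scalar, which `Submodule.map`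
ignores).  No `W`, no `f^* = p^*`, no `T_Y ⊔ Alg²(Y) = ⊤`. [cite: Fulton1998, §16.1 Def. 16.1.2]
[cite: VoisinHodgeII2003, proof of Thm. 10.17 (10.7)] [cite: arXiv:2607.18341, §1.15] -/
def HasCorrCarrier (A : AbelianVariety ℂ) (T : Submodule ℂ (complexBetti A.X (2 * 2))) : Prop :=
  ∃ (m : ℕ) (Y : Literature.AlgebraicGeometry.Motives.SchemeOver ℂ) (hY : Literature.AlgebraicGeometry.Motives.IsSmoothProjective m Y) (TY : Submodule ℂ (Literature.AlgebraicGeometry.HodgeTheory.complexBetti Y (2 * 2))) (γ : Literature.AlgebraicGeometry.HodgeTheory.complexBetti (A.X ⊗ Y) (2 * m)), Module.finrank ℂ TY = 70 ∧ TY ≤ Submodule.span ℂ {c | c ∈ TY ∧ Literature.AlgebraicGeometry.HodgeTheory.IsRationalClass c} ∧ TY ≤ Submodule.span ℂ {c | c ∈ TY ∧ ∃ p q : ℕ, p + q = 4 ∧ Literature.AlgebraicGeometry.HodgeTheory.IsOfHodgeType m Y (2 * 2) p q c} ∧ (∀ c ∈ Submodule.span ℂ {x | ∃ u ∈ TY,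 ∃ v ∈ TY, x = Literature.AlgebraicTopology.SingularHomology.cupProduct (show 2 * 2 + 2 * 2 = 2 * 4 from rfl) (Literature.AlgebraicGeometry.HodgeTheory.complexBetti.map (CartesianMonoidalCategory.fst Y Y) (2 * 2) u) (Literature.AlgebraicGeometry.HodgeTheory.complexBetti.map (CartesianMonoidalCategory.snd Y Y) (2 * 2) v)}, Literature.AlgebraicGeometry.HodgeTheory.IsRationalClass c → Literature.AlgebraicGeometry.HodgeTheory.IsOfHodgeType (m + m) (Y ⊗ Y) (2 * 4) 4 4 c → c ∈ Literature.AlgebraicGeometry.HodgeTheory.algebraicClasses (Y ⊗ Y) 4) ∧ γ ∈ Literature.AlgebraicGeometry.HodgeTheory.algebraicClasses (A.X ⊗ Y) m ∧ ∀ μ : Literature.AlgebraicGeometry.HodgeTheory.OrientationFamily, μ.HasPoincareDuality → TY.map (Literature.AlgebraicGeometry.HodgeTheory.corrAction μ (Literature.AlgebraicGeometry.Motives.AbelianVariety.isSmoothProjective_holds (A := A) : Literature.AlgebraicGeometry.Motives.IsSmoothProjective A.dim A.X) hY (rfl : 2 * 2 + 2 * m = 2 * 2 + 2 * m) γ) =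 T

/-- **`CorrCarrierOfCYFormEight`** — X1corr's deciding step (STUB 2): every CY form of a Hodge-general split
eightfold has a correspondence carrier.  OPEN (the realisation problem in its weakest useful form: an algebraic
class on `A × Y` inducing `T_Y ≅ T`; price = algebraicity of ONE Hodge class on `A × Y` for a Hodge-general `A`).
[cite: arXiv:2607.18341, §1.15] -/
def CorrCarrierOfCYFormEight : Prop :=
  ∀ d : ℕ, 0 < d → ∀ (A : AbelianVariety ℂ) (φ : A ⟶ A) (e : ProjectiveEmbedding A.X)
    (a : complexBetti (projectiveSpace e.n ℂ) 2), A.dim = 2 * 4 → φ ≫ φ = -(d • 𝟙 A) → IsRationalClass a → a ≠ 0 →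
    IsHyperbolicWeilType A φ 4 (symH d φ e a) →
    Literature.AlgebraicGeometry.VanGeemen1994.HasHodgeGroupSU A φ 4 d (symH d φ e a) →
    ∀ T : Submodule ℂ (complexBetti A.X (2 * 2)), IsCYFormAt d A φ T → HasCorrCarrier A T

/-- The route decl X1corr IS `∀ …, hypotheses → ∃ T, IsCYFormAt ∧ HasCorrCarrier` (copy check of the gate-rendered
text against this file's named clause bundles, up to currying and the `⊗` notation). -/
theorem cyFormCorrCarrierEight_iff :
    Summit.HodgeConjecture.HodgeConjecture.Theses.CYFormCasimir.CYFormCorrCarrierEight ↔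
      ∀ d : ℕ, 0 < d → ∀ (A : AbelianVariety ℂ) (φ : A ⟶ A) (e : ProjectiveEmbedding A.X)
        (a : complexBetti (projectiveSpace e.n ℂ) 2), A.dim = 2 * 4 → φ ≫ φ = -(d • 𝟙 A) → IsRationalClass a → a ≠ 0 →
        IsHyperbolicWeilType A φ 4 (symH d φ e a) →
        Literature.AlgebraicGeometry.VanGeemen1994.HasHodgeGroupSU A φ 4 d (symH d φ e a) →
        ∃ T : Submodule ℂ (complexBetti A.X (2 * 2)), IsCYFormAt d A φ T ∧ HasCorrCarrier A T := by
  constructor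
  · intro h d hd A φ e a h1 h2 h3 h4 h5 h6
    obtain ⟨T, c1, c2, c3, c4, c5, hc⟩ := h d hd A φ e a h1 h2 h3 h4 h5 h6
    exact ⟨T, ⟨c1, c2, c3, c4, c5⟩, hc⟩
  · intro h d hd A φ e a h1 h2 h3 h4 h5 h6
    obtain ⟨T, ⟨c1, c2, c3, c4, c5⟩, hc⟩ := h d hd A φ e a h1 h2 h3 h4 h5 h6
    exact ⟨T, c1, c2, c3, c4, c5, hc⟩

/-! ## §1 The named CM anchor `P = S_d⁴`, `S_d = E₀ × E₀`, `ψ = (ψ₀ × (−ψ₀))⁴`, the swap `σ = s⁴`, the carrier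
`Y = S² ≅ E₀⁴`, and the EXPLICIT CY form `T₀ = (𝟙 + σ^*)(⋀⁴W^*)` -/

section Anchor

variable (E₀ : AbelianVariety ℂ) (ψ₀ : E₀ ⟶ E₀)

/-- The Weil surface `S = E₀ × E₀`. -/
abbrev weilSurf : AbelianVariety ℂ := E₀.prod E₀

/-- Its Weil action `φ_S = ψ₀ × (−ψ₀)` (signature `(1,1)`). -/
abbrev weilSurfAct : weilSurf E₀ ⟶ weilSurf E₀ :=
  AbelianVariety.prodLift (AbelianVariety.fst E₀ E₀ ≫ ψ₀) (AbelianVariety.snd E₀ E₀ ≫ (-ψ₀))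

/-- The factor swap `s = (pr₂, pr₁)` of `S` (an involution ANTI-commuting with `φ_S`). -/
abbrev weilSurfSwap : weilSurf E₀ ⟶ weilSurf E₀ :=
  AbelianVariety.prodLift (AbelianVariety.snd E₀ E₀) (AbelianVariety.fst E₀ E₀)

/-- `S² = S × S` — as a VARIETY this is `E₀⁴`: **the named carrier `Y` of the rung** (`T_Y = H⁴(Y)`). -/
abbrev pad2Anchor : AbelianVariety ℂ := (weilSurf E₀).prod (weilSurf E₀)
/-- `S³ = S² × S`. -/
abbrev pad3Anchor : AbelianVariety ℂ := (pad2Anchor E₀).prod (weilSurf E₀)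
/-- **The CM anchor** `P = S⁴ = S³ × S` (complex torus `≅ E₀⁸`; Weil structure `(√-d, −√-d)⁴`, signature `(4,4)`). -/
abbrev pad4Anchor : AbelianVariety ℂ := (pad3Anchor E₀).prod (weilSurf E₀)

/-- Product action on `S²`. -/
abbrev pad2Action : pad2Anchor E₀ ⟶ pad2Anchor E₀ :=
  AbelianVariety.prodLift (AbelianVariety.fst _ _ ≫ weilSurfAct E₀ ψ₀) (AbelianVariety.snd _ _ ≫ weilSurfAct E₀ ψ₀)
/-- Product action on `S³`. -/
abbrev pad3Action : pad3Anchor E₀ ⟶ pad3Anchor E₀ :=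
  AbelianVariety.prodLift (AbelianVariety.fst _ _ ≫ pad2Action E₀ ψ₀) (AbelianVariety.snd _ _ ≫ weilSurfAct E₀ ψ₀)
/-- **The anchor's `K`-action** `ψ = φ_S⁴` on `S⁴`. -/
abbrev pad4Action : pad4Anchor E₀ ⟶ pad4Anchor E₀ :=
  AbelianVariety.prodLift (AbelianVariety.fst _ _ ≫ pad3Action E₀ ψ₀) (AbelianVariety.snd _ _ ≫ weilSurfAct E₀ ψ₀)

/-- Swap on `S²`. -/
abbrev pad2Swap : pad2Anchor E₀ ⟶ pad2Anchor E₀ :=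
  AbelianVariety.prodLift (AbelianVariety.fst _ _ ≫ weilSurfSwap E₀) (AbelianVariety.snd _ _ ≫ weilSurfSwap E₀)
/-- Swap on `S³`. -/
abbrev pad3Swap : pad3Anchor E₀ ⟶ pad3Anchor E₀ :=
  AbelianVariety.prodLift (AbelianVariety.fst _ _ ≫ pad2Swap E₀) (AbelianVariety.snd _ _ ≫ weilSurfSwap E₀)
/-- **The swap involution `σ = s⁴` of `S⁴`** (anti-commutes with `ψ`: `Theorems.CYFormCarrier.pad4Swap_anticomm`). -/
abbrev pad4Swap : pad4Anchor E₀ ⟶ pad4Anchor E₀ :=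
  AbelianVariety.prodLift (AbelianVariety.fst _ _ ≫ pad3Swap E₀) (AbelianVariety.snd _ _ ≫ weilSurfSwap E₀)

/-- **The explicit CY form at the anchor**: `T₀ = (𝟙 + σ^*)(⋀⁴W^*)`, `⋀⁴W^* = weilClassesMinus P ψ 2 d`
(landed: `Theorems.CYFormCarrier.isCYForm_fixedForm_pad4Anchor`). [cite: arXiv:1109.5632, §3.5 Prop. 37] -/
abbrev cyFormAnchor (d : ℕ) : Submodule ℂ (complexBetti (pad4Anchor E₀).X (2 * 2)) :=
  (weilClassesMinus (pad4Anchor E₀) (pad4Action E₀ ψ₀) 2 d).map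
    (LinearMap.id + (complexBetti.map (pad4Swap E₀).hom.hom.hom (2 * 2)).hom)

variable {E₀ ψ₀}

/-- `dim S = 2·1`. -/
theorem weilSurf_dim (hE : E₀.dim = 1) : (weilSurf E₀).dim = 2 * 1 := by
  show (E₀.prod E₀).dim = 2 * 1
  rw [AbelianVariety.dim_prod, hE]

/-- `dim S² = 4` (the carrier is a FOURFOLD: `m = 4`). -/
theorem pad2Anchor_dim (hE : E₀.dim = 1) : (pad2Anchor E₀).dim = 4 := by
  have h1 := weilSurf_dim hE
  have h2 : (pad2Anchor E₀).dim = 2 * (1 + 1) := dim_prod_eq_two_mul h1 h1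
  simpa using h2

/-- **`dim S⁴ = 2·4`.** -/
theorem pad4Anchor_dim (hE : E₀.dim = 1) : (pad4Anchor E₀).dim = 2 * 4 := by
  have h1 := weilSurf_dim hE
  have h2 : (pad2Anchor E₀).dim = 2 * (1 + 1) := dim_prod_eq_two_mul h1 h1
  have h3 : (pad3Anchor E₀).dim = 2 * ((1 + 1) + 1) := dim_prod_eq_two_mul h2 h1
  have h4 : (pad4Anchor E₀).dim = 2 * (((1 + 1) + 1) + 1) := dim_prod_eq_two_mul h3 h1
  simpa using h4

/-- `(−ψ₀)² = ψ₀²`. -/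
theorem neg_comp_neg_eq {d : ℕ} (hψ : ψ₀ ≫ ψ₀ = -(d • 𝟙 E₀)) : (-ψ₀) ≫ (-ψ₀) = -(d • 𝟙 E₀) := by
  rw [Preadditive.neg_comp_neg]; exact hψ

/-- `φ_S ≫ φ_S = -d`. -/
theorem weilSurfAct_comp_self {d : ℕ} (hψ : ψ₀ ≫ ψ₀ = -(d • 𝟙 E₀)) :
    weilSurfAct E₀ ψ₀ ≫ weilSurfAct E₀ ψ₀ = -(d • 𝟙 (weilSurf E₀)) :=
  prodLift_comp_self_eq_neg_nsmul hψ (neg_comp_neg_eq hψ)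

/-- **`ψ ≫ ψ = -d` on `S⁴`.** -/
theorem pad4Action_comp_self {d : ℕ} (hψ : ψ₀ ≫ ψ₀ = -(d • 𝟙 E₀)) :
    pad4Action E₀ ψ₀ ≫ pad4Action E₀ ψ₀ = -(d • 𝟙 (pad4Anchor E₀)) := by
  have hS := weilSurfAct_comp_self hψ
  have h2 : pad2Action E₀ ψ₀ ≫ pad2Action E₀ ψ₀ = -(d • 𝟙 (pad2Anchor E₀)) :=
    prodLift_comp_self_eq_neg_nsmul hS hS
  have h3 : pad3Action E₀ ψ₀ ≫ pad3Action E₀ ψ₀ = -(d • 𝟙 (pad3Anchor E₀)) :=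
    prodLift_comp_self_eq_neg_nsmul h2 hS
  exact prodLift_comp_self_eq_neg_nsmul h3 hS

/-- `σ ≫ ψ = -(ψ ≫ σ)` (landed, written-out form: `Theorems.CYFormCarrier.pad4Swap_anticomm`). -/
theorem pad4Swap_anticomm' :
    pad4Swap E₀ ≫ pad4Action E₀ ψ₀ = -(pad4Action E₀ ψ₀ ≫ pad4Swap E₀) :=
  Summit.HodgeConjecture.HodgeConjecture.Theorems.CYFormCarrier.pad4Swap_anticomm

/-- `σ ≫ σ = 𝟙` (landed: `Theorems.CYFormCarrier.pad4Swap_comp_self`). -/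
theorem pad4Swap_comp_self' : pad4Swap E₀ ≫ pad4Swap E₀ = 𝟙 (pad4Anchor E₀) :=
  Summit.HodgeConjecture.HodgeConjecture.Theorems.CYFormCarrier.pad4Swap_comp_self

/-- **The CY-form half of the rung is SETTLED**: `T₀ = cyFormAnchor` satisfies the five `IsCYFormAt` clauses at
`(P, ψ) = (S⁴, φ_S⁴)` for every `d > 0` and every CM datum (landed p600857,
`Theorems.CYFormCarrier.isCYForm_fixedForm_pad4Anchor`; this is its named form). [cite: arXiv:1109.5632, §3.5 Prop. 37] -/
theorem isCYFormAt_cyFormAnchor {d : ℕ} (hd : 0 < d) (hE : E₀.dim = 1) (hψ : ψ₀ ≫ ψ₀ = -(d • 𝟙 E₀)) :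
    IsCYFormAt d (pad4Anchor E₀) (pad4Action E₀ ψ₀) (cyFormAnchor E₀ ψ₀ d) :=
  Summit.HodgeConjecture.HodgeConjecture.Theorems.CYFormCarrier.isCYForm_fixedForm_pad4Anchor hd hE hψ

/-- The anchor exists for every `d > 0` (a CM curve with `ψ₀² = -d` exists: `exists_cmCurve_sqrt_neg`). -/
theorem exists_anchor (d : ℕ) (hd : 0 < d) :
    ∃ (E₀ : AbelianVariety ℂ) (ψ₀ : E₀ ⟶ E₀), E₀.dim = 1 ∧ ψ₀ ≫ ψ₀ = -(d • 𝟙 E₀) ∧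
      (pad4Anchor E₀).dim = 2 * 4 ∧ pad4Action E₀ ψ₀ ≫ pad4Action E₀ ψ₀ = -(d • 𝟙 (pad4Anchor E₀)) := by
  obtain ⟨E₀, ψ₀, hE, hψ⟩ := Literature.NumberTheory.EllipticCurves.CMEndomorphism.exists_cmCurve_sqrt_neg d hd
  exact ⟨E₀, ψ₀, hE, hψ, pad4Anchor_dim hE, pad4Action_comp_self hψ⟩

end Anchor

/-! ## §1b (v5.4) The TRIVIAL (self-)correspondence carrier and STUB 3's proof — `(Y, T_Y, γ) = (A, T, [Δ_A])`

For ANY complex abelian variety `A` and ANY `T ⊂ H⁴(A)` of dimension 70 spanned by rational and by pure-type classes,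
`HasCorrCarrier A T` holds with `Y = A.X`, `m = dim A`, `T_Y = T`, `γ = (𝟙, 𝟙)₊1 = [Δ_A]` AS SOON AS every rational
`(4,4)`-class of `H⁸(A × A)` is algebraic (`hasCorrCarrier_self`): the diagonal class is algebraic
(`gysinGraph_one_mem_algebraicClasses`) and acts as the identity (`corrAction_gysinGraph_one`, packaged in
`exists_algebraic_corrAction_eq_of_pushPull` with `f = g = 𝟙`, `c = 1`) for the complex orientation family, hence as a
non-zero scalar for every orientation family with Poincaré duality (`corrAction_eq_smul_of_orientationFamily`), which
`Submodule.map` ignores.  At the CM anchor `P = S⁴` the square clause is the instance `p = 4` of HC for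
`P × P ≅ E₀¹⁶`, a TREE THEOREM for every complex elliptic curve (`EllSlots.hodgeConjectureFor'`, Tate–Murasaki /
van Geemen Thm. 4.3 / Moonen–Zarhin Cor. 3.9), so STUB 3 is PROVED with `T = T₀ = cyFormAnchor`
(`correspondenceCarrier_at_CM_point_rung`; tribunal-w hodge-trib-w-cyf g3, 2026-08-28).  HONEST FRAMING: inside the
tree-known regime (J r2 / r2a), width 0 toward H2; the T3 chip stays PLAN-ONLY on STUB 4 / STUB 5.  STRUCTURAL REMARK:
at a Hodge-general eightfold the same self-carrier shows X1corr ⇐ «the rational `(4,4)`-classes of `H⁸(A × A)` are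
algebraic» — the typed carrier block has no content beyond its square clause unless `Y ≠ A` is demanded.
[cite: Fulton1998, §16.1 Prop. 16.1.1–16.1.2] [cite: vanGeemen1994HodgeAV, Thm. 4.3] [cite: MoonenZarhin1999LowDim, Cor. (3.9)] -/

section TrivialCarrier

/-- **The trivial correspondence carrier** `(Y, T_Y, γ) = (A.X, T, [Δ_A])`, granted the square clause on `A × A`.
[cite: Fulton1998, §16.1 Prop. 16.1.1–16.1.2] -/
theorem hasCorrCarrier_self {A : AbelianVariety ℂ} {T : Submodule ℂ (complexBetti A.X (2 * 2))}
    (h70 : Module.finrank ℂ T = 70)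
    (hrat : T ≤ Submodule.span ℂ {c | c ∈ T ∧ IsRationalClass c})
    (hpure : T ≤ Submodule.span ℂ {c | c ∈ T ∧ ∃ p q : ℕ, p + q = 4 ∧ IsOfHodgeType A.dim A.X (2 * 2) p q c})
    (hsq : ∀ c : complexBetti (A.X ⊗ A.X) (2 * 4), IsRationalClass c →
      IsOfHodgeType (A.dim + A.dim) (A.X ⊗ A.X) (2 * 4) 4 4 c → c ∈ algebraicClasses (A.X ⊗ A.X) 4) :
    HasCorrCarrier A T := by
  have hX : IsSmoothProjective A.dim A.X := AbelianVariety.isSmoothProjective_holds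
  have hμ₀ : complexOrientationFamily.HasPoincareDuality := hasPoincareDuality_complexOrientationFamily
  -- the diagonal `γ = (𝟙, 𝟙)₊1` is algebraic and acts as the identity on `H⁴(A)`
  obtain ⟨γ, hγalg, hγact⟩ :=
    exists_algebraic_corrAction_eq_of_pushPull (μ := complexOrientationFamily) hμ₀ hX (a := 2 * 2)
      (T := (LinearMap.id : complexBetti A.X (2 * 2) →ₗ[ℂ] complexBetti A.X (2 * 2)))
      ⟨A.X, hX, 𝟙 A.X, 𝟙 A.X, 1, by
        rw [complexGysin_id hμ₀ hX (2 * 2), complexBetti.map_id, ModuleCat.hom_id, LinearMap.id_comp, one_smul]⟩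
  refine ⟨A.dim, A.X, hX, T, γ, h70, hrat, hpure, fun c _ hcQ hc44 ↦ hsq c hcQ hc44, hγalg, fun μ hμ ↦ ?_⟩
  obtain ⟨t, ht, hμt⟩ := corrAction_eq_smul_of_orientationFamily hμ₀ hμ hX hX
    (rfl : 2 * 2 + 2 * A.dim = 2 * 2 + 2 * A.dim)
  have key : corrAction μ (AbelianVariety.isSmoothProjective_holds (A := A) : IsSmoothProjective A.dim A.X) hX
      (rfl : 2 * 2 + 2 * A.dim = 2 * 2 + 2 * A.dim) γ = t • LinearMap.id := by
    rw [hμt, LinearMap.smul_apply, hγact]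
  rw [key, Submodule.map_smul _ _ _ ht, Submodule.map_id]

variable {E₀ : AbelianVariety ℂ}

/-- `S⁴ × S⁴` is a product of sixteen copies of `E₀` in a fixed bracketing, so it carries an `E₀`-slot structure and ALL
its Hodge classes are algebraic, for EVERY complex elliptic curve `E₀` (`EllSlots.hodgeConjectureFor'`).
[cite: vanGeemen1994HodgeAV, Thm. 4.3] [cite: MoonenZarhin1999LowDim, Cor. (3.9)] -/
theorem hodgeConjectureFor_pad4Anchor_prod (hE : E₀.dim = 1) :
    HodgeConjectureFor ((pad4Anchor E₀).prod (pad4Anchor E₀)).dim ((pad4Anchor E₀).prod (pad4Anchor E₀)).X := by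
  have hS := (ellSlots_self hE).prod (ellSlots_self hE)
  have h2 := hS.prod hS
  have h3 := h2.prod hS
  have h4 := h3.prod hS
  exact (h4.prod h4).hodgeConjectureFor' hE

/-- **The square clause of the self-carrier at the anchor**: every rational `(4,4)`-class of `H⁸(S⁴(ℂ) × S⁴(ℂ); ℂ)` is
algebraic (`AbelianVariety.dim_prod` moves the dimension index to `dim P + dim P`).
[cite: vanGeemen1994HodgeAV, Thm. 4.3] [cite: MoonenZarhin1999LowDim, Cor. (3.9)] -/
theorem squareClause_pad4Anchor (hE : E₀.dim = 1) :
    ∀ c : complexBetti ((pad4Anchor E₀).X ⊗ (pad4Anchor E₀).X) (2 * 4), IsRationalClass c →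
      IsOfHodgeType ((pad4Anchor E₀).dim + (pad4Anchor E₀).dim) ((pad4Anchor E₀).X ⊗ (pad4Anchor E₀).X) (2 * 4) 4 4 c →
      c ∈ algebraicClasses ((pad4Anchor E₀).X ⊗ (pad4Anchor E₀).X) 4 := by
  have hHC := hodgeConjectureFor_pad4Anchor_prod hE
  rw [AbelianVariety.dim_prod] at hHC
  intro c hcQ hc
  exact hHC.2 4 c hcQ hc

/-- **`HasCorrCarrier` at the anchor for `T₀ = cyFormAnchor`** (self-carrier + square clause + `dim P = 2·4`). -/
theorem hasCorrCarrier_cyFormAnchor {d : ℕ} (hd : 0 < d) (hE : E₀.dim = 1) {ψ₀ : E₀ ⟶ E₀}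
    (hψ : ψ₀ ≫ ψ₀ = -(d • 𝟙 E₀)) : HasCorrCarrier (pad4Anchor E₀) (cyFormAnchor E₀ ψ₀ d) := by
  obtain ⟨-, -, c3, c4, c5⟩ := isCYFormAt_cyFormAnchor hd hE hψ
  refine hasCorrCarrier_self c3 c4 ?_ (squareClause_pad4Anchor hE)
  rw [pad4Anchor_dim hE]
  exact c5

/-- **THE RUNG PROVED** (STUB 3's statement verbatim): witness `T₀ = cyFormAnchor` with the self-carrier `(P, T₀, [Δ])`. -/
theorem correspondenceCarrier_at_CM_point_rung :
    ∀ d : ℕ, 0 < d → ∀ (E₀ : AbelianVariety ℂ) (ψ₀ : E₀ ⟶ E₀), E₀.dim = 1 → ψ₀ ≫ ψ₀ = -(d • 𝟙 E₀) →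
      ∃ T : Submodule ℂ (complexBetti (pad4Anchor E₀).X (2 * 2)),
        IsCYFormAt d (pad4Anchor E₀) (pad4Action E₀ ψ₀) T ∧ HasCorrCarrier (pad4Anchor E₀) T :=
  fun d hd E₀ ψ₀ hE hψ ↦ ⟨cyFormAnchor E₀ ψ₀ d, isCYFormAt_cyFormAnchor hd hE hψ, hasCorrCarrier_cyFormAnchor hd hE hψ⟩

end TrivialCarrier

/-! ## §2 Registered stubs (the `sorry`s of this file: STUB 2 here, STUB 4 in §5 (v5.2), STUB 5 in §6 (v5.3); STUB 1 and — v5.4, §1b — STUB 3 are PROVED) -/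

/-- **STUB 1 — `CYFormExistsEight`** (verbatim v3): the CY `ℚ`-form `T` exists on every Hodge-general split
`ℚ(√-d)`-Weil eightfold (the fixed space of the FL13 Hodge star `⋆` on `⋀⁴_K H¹(A)`, read through
`pullbackEigenclasses`).  Size M–L; mathematics in print, the work is typing; stub plan
`STUB-PLAN-stub_cyform_exists.md` (S1–S4) and 11 landed helper files (p600356…p604107).  LOAD-BEARING binder 1 of
`CYFormCarrierEight_of`. [cite: arXiv:1109.5632, §2.4.2 p.14 and Prop. 37] [cite: arXiv:math/0008076, Thm. 3.10]
[cite: vanGeemen1994HodgeAV, 6.12] -/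
theorem stub_cyform_exists :
    ∀ d : ℕ, 0 < d → ∀ (A : AbelianVariety ℂ) (φ : A ⟶ A) (e : ProjectiveEmbedding A.X)
      (a : complexBetti (projectiveSpace e.n ℂ) 2), A.dim = 2 * 4 → φ ≫ φ = -(d • 𝟙 A) → IsRationalClass a → a ≠ 0 →
      IsHyperbolicWeilType A φ 4 (symH d φ e a) →
      Literature.AlgebraicGeometry.VanGeemen1994.HasHodgeGroupSU A φ 4 d (symH d φ e a) →
      ∃ T : Submodule ℂ (complexBetti A.X (2 * 2)), IsCYFormAt d A φ T :=
  -- PROVED (p611494, prover hodge-cyf-x1-p1 g2): the landed `Theorems.CYFormCarrier.cyFormExists_eight` has exactly this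
  -- signature with `symH`, `IsCYFormAt` inlined; kept under its stub name so the composition below is unchanged.
  fun d hd A φ e a hA hφ ha ha0 hhyp hSU ↦
    Summit.HodgeConjecture.HodgeConjecture.Theorems.CYFormCarrier.cyFormExists_eight d hd A φ e a hA hφ ha ha0 hhyp hSU

/-- **STUB 2 — `stub_corrCarrier_of_cyform : CorrCarrierOfCYFormEight` (THE DECIDING STUB of X1corr: the open
realisation problem in correspondence form)**: on a Hodge-general split eightfold every CY form `T` has a
CORRESPONDENCE carrier `(Y, T_Y, γ)` (`HasCorrCarrier`).  Size XL / open.  Replaces v4's clause-exact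
`stub_carrier_of_cyform` (dead for every named `Y` with `b₈(Y) < 2485`, J-NOGO; no ring map is asked of `γ_*` here).
LOAD-BEARING binder 2 of `CYFormCorrCarrierEight_of`.  First rung: STUB 3 (the same ∃-conclusion at the CM anchor).
[cite: arXiv:2607.18341, §1.15] [cite: arXiv:1109.5632, p.4] [cite: arXiv:1407.0833, Thm. 1.2] -/
theorem stub_corrCarrier_of_cyform : CorrCarrierOfCYFormEight := by
  sorry

/-- **STUB 3 — THE RUNG `stub_correspondenceCarrier_at_CM_point` — PROVED (v5.4, §1b: the TRIVIAL self-carrier `(Y, T_Y, γ) =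
(P.X, T₀, [Δ_P])`, square clause = HC⁴(`P × P ≅ E₀¹⁶`), a tree theorem; term `correspondenceCarrier_at_CM_point_rung`).  The NAMED
NON-TRIVIAL witness below (`Y = E₀⁴`, §3 clauses R1/R2/R3) is NOT needed for the stub and remains the transport-infrastructure line.
ORIGINAL TEXT (v4–v5.3): **THE RUNG (BC5 / tribunal T3; v4, replaces v3's
`stub_carrier_at_CM_point`)**: at the NAMED CM anchor `P = S_d⁴ ≅ E₀⁸` (`K = ℚ(√-d)` acting by `(ψ₀, −ψ₀)⁴`,
signature `(4,4)`), for EVERY `d > 0` and every CM datum `(E₀, ψ₀)`: the ∃-conclusion of the PIVOTED crux X1corr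
(`CYFormCasimir.CYFormCorrCarrierEight`, the route decl) verbatim — a CY form `T` WITH A CORRESPONDENCE CARRIER `HasCorrCarrier P T`.
NAMED WITNESS (§3): `T = T₀ = cyFormAnchor` (settled: `isCYFormAt_cyFormAnchor`); `Y = pad2Anchor E₀ = S² ≅ E₀⁴`
(`m = 4`), `T_Y = ⊤ = H⁴(E₀⁴)` (70-dim, Hodge numbers `(1,16,36,16,1)` = those of `T₀`; all `Y`-side clauses are
tree lemmas), square clause on `Y ⊗ Y ≅ E₀⁸` = an instance of HC for products of elliptic curves
(`vanGeemen1994_thm43_hodgeConjectureFor`, UNCONDITIONAL in tree), and the correspondence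
`γ = Σ_{j=0}^{4} β_j([Γᵗ_{g_j}] + [Γᵗ_{σ ≫ g_j}])`, `g_j = (n·𝟙 + ψ)^j ≫ m_Σ : S⁴ → E₀⁴` (`m_Σ` = coordinatewise
sum, `n = d + 1`, `β_j` = Lagrange coefficients of the projector `Π₋` onto `⋀⁴V₋`), for which
`γ_* = (𝟙 + σ^*) ∘ Π₋ ∘ m_Σ^*` maps `H⁴(E₀⁴)` isomorphically onto `T₀` (`Π₋ ∘ m_Σ^* = ⋀⁴(q_y^*π^{1,0} + q_x^*π^{0,1})`).
Reduction to three named clauses: `stub_correspondenceCarrier_at_CM_point_of_clauses` (§3, kernel-checked).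
WHY IT MIGHT FAIL: only by a convention slip in the typing (`V₊` vs `V₋` in `weilClassesMinus`, first-factor-
receives in `corrAction`, the `(m+m)`-index of `IsOfHodgeType` on `Y ⊗ Y`) — each repairable by the symmetric
choice; the mathematics (HC for `E₀ⁿ`, push–pull) is classical.  Outside H2's known regime (split SIXFOLDS);
exercises the lever (CY form + correspondence carrier ⇒ Casimir transport `κ = δ^*((γ ⊠ γ)_* c_Y)`), not the
algebraicity of Weil classes.  NOT a binder of `CYFormCorrCarrierEight_of` (a rung beside the crux: X1corr's
Hodge-generality hypotheses fail at CM points).  J-NOGO honoured: no ring map is asked of `γ_*`, so `b₈(Y) ≥ 2485`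
does not apply; the clause-exact `m = 4` transport is NOT restated. [cite: Fulton1998, §16.1 Prop. 16.1.1–16.1.2]
[cite: vanGeemen1994HodgeAV, Thm. 4.3] [cite: MoonenZarhin1999LowDim, Cor. (3.9)] [cite: arXiv:1109.5632, Prop. 37]
[cite: Schoen1998HodgeWeilAddendum, §10] -/
theorem stub_correspondenceCarrier_at_CM_point :
    ∀ d : ℕ, 0 < d → ∀ (E₀ : AbelianVariety ℂ) (ψ₀ : E₀ ⟶ E₀), E₀.dim = 1 → ψ₀ ≫ ψ₀ = -(d • 𝟙 E₀) →
      ∃ T : Submodule ℂ (complexBetti (pad4Anchor E₀).X (2 * 2)),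
        IsCYFormAt d (pad4Anchor E₀) (pad4Action E₀ ψ₀) T ∧ HasCorrCarrier (pad4Anchor E₀) T :=
  correspondenceCarrier_at_CM_point_rung

/-- v3's clause-exact rung, RETIRED from the stub list (statement only; its named `m = 4` candidate is refuted by
J-NOGO cup-square rank — constraints on any witness: `m ≥ 8`, `b₈(Y) ≥ 2485`, `T_Y` not generated by `H¹(Y)`; no
candidate in print).  Kept so the dead/alive distinction is visible: this Prop is OPEN, un-planned, un-staffed. -/
def ClauseExactRungAt (d : ℕ) (E₀ : AbelianVariety ℂ) (ψ₀ : E₀ ⟶ E₀) : Prop :=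
  ∃ T : Submodule ℂ (complexBetti (pad4Anchor E₀).X (2 * 2)),
    IsCYFormAt d (pad4Anchor E₀) (pad4Action E₀ ψ₀) T ∧ HasCarrier (pad4Anchor E₀) T

/-! ## §3 Composition and the rung's reduction (kernel-checked; no `sorry` in §3–§4) -/

/-- **`CYFormCorrCarrierEight_of`** — CY-form existence and the correspondence-carrier step give the crux X1corr's
DEFINING STATEMENT (the right-hand side of the copy check `cyFormCorrCarrierEight_iff`, i.e. the route decl
unfolded).  v5.1 (hodge-cyf-w-1 g1): the conclusion is deliberately the UNFOLDED form, not the route constant, so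
that exactly ONE theorem of this file — `CYFormCorrCarrierEight_of_stubs` below — concludes the crux BY NAME (the
skeleton audit takes the first crux-headed theorem in environment order and admits only tagged / stub-named Prop
binders; with two crux-headed theorems v5-as-minted drew this one and bounced `skeleton.extra-hypothesis` ×2). -/
theorem CYFormCorrCarrierEight_of
    (hT : ∀ d : ℕ, 0 < d → ∀ (A : AbelianVariety ℂ) (φ : A ⟶ A) (e : ProjectiveEmbedding A.X)
      (a : complexBetti (projectiveSpace e.n ℂ) 2), A.dim = 2 * 4 → φ ≫ φ = -(d • 𝟙 A) → IsRationalClass a → a ≠ 0 →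
      IsHyperbolicWeilType A φ 4 (symH d φ e a) →
      Literature.AlgebraicGeometry.VanGeemen1994.HasHodgeGroupSU A φ 4 d (symH d φ e a) →
      ∃ T : Submodule ℂ (complexBetti A.X (2 * 2)), IsCYFormAt d A φ T)
    (hC : CorrCarrierOfCYFormEight) :
    ∀ d : ℕ, 0 < d → ∀ (A : AbelianVariety ℂ) (φ : A ⟶ A) (e : ProjectiveEmbedding A.X)
      (a : complexBetti (projectiveSpace e.n ℂ) 2), A.dim = 2 * 4 → φ ≫ φ = -(d • 𝟙 A) → IsRationalClass a → a ≠ 0 →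
      IsHyperbolicWeilType A φ 4 (symH d φ e a) →
      Literature.AlgebraicGeometry.VanGeemen1994.HasHodgeGroupSU A φ 4 d (symH d φ e a) →
      ∃ T : Submodule ℂ (complexBetti A.X (2 * 2)), IsCYFormAt d A φ T ∧ HasCorrCarrier A T := by
  intro d hd A φ e a h1 h2 h3 h4 h5 h6
  obtain ⟨T, hTT⟩ := hT d hd A φ e a h1 h2 h3 h4 h5 h6
  exact ⟨T, hTT, hC d hd A φ e a h1 h2 h3 h4 h5 h6 T hTT⟩

/-- **`CYFormCorrCarrierEight_of_stubs` — THE skeleton theorem**: the crux X1corr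
(`CYFormCasimir.CYFormCorrCarrierEight`, the route decl) concluded BY NAME from the registered stubs — STUB 1
`stub_cyform_exists` (proved) and STUB 2 `stub_corrCarrier_of_cyform` (sorried, load-bearing) — through
`CYFormCorrCarrierEight_of` and the copy check `cyFormCorrCarrierEight_iff`.  Hypothesis-free; the only theorem of
this file whose conclusion is the route constant (so the skeleton audit keys on it deterministically). -/
theorem CYFormCorrCarrierEight_of_stubs : Summit.HodgeConjecture.HodgeConjecture.Theses.CYFormCasimir.CYFormCorrCarrierEight :=
  cyFormCorrCarrierEight_iff.mpr (CYFormCorrCarrierEight_of stub_cyform_exists stub_corrCarrier_of_cyform)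

section RungReduction

variable {d : ℕ} {E₀ : AbelianVariety ℂ} {ψ₀ : E₀ ⟶ E₀}

/-- The smoothness certificate of the anchor in the `A.dim`-indexed form `HasCorrCarrier` uses. -/
theorem pad4Anchor_smooth : IsSmoothProjective (pad4Anchor E₀).dim (pad4Anchor E₀).X :=
  AbelianVariety.isSmoothProjective_holds

/-- The carrier `Y = S²` is a smooth projective FOURFOLD. -/
theorem pad2Anchor_smooth (hE : E₀.dim = 1) : IsSmoothProjective 4 (pad2Anchor E₀).X :=
  isSmoothProjective_of_dim_eq' (pad2Anchor_dim hE)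

variable (d E₀ ψ₀) in
/-- **Clause (R1) `GraphPullbackIsCorrAt`** — PUSH–PULL FOR TRANSPOSED GRAPHS, two-factor form at the anchor: for
every orientation family `μ` with Poincaré duality there is ONE non-zero scalar `t` such that every homomorphism
`g : P → Y` has an algebraic class `γ_g ∈ Alg⁴(P ⊗ Y)` — not depending on `μ` — with `(γ_g)_* = t • g^*` on `H⁴`.
Plan: `γ_g = (𝟙, g)₊1` computed with the tree's `complexOrientationFamily`; port `corrAction_gysinGraph_one` /
`gysinGraph_one_mem_algebraicClasses` (stated for `X ⊗ X`) to `W ⊗ X`, `complexGysin_id`, and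
`corrAction_eq_smul_of_orientationFamily` for the uniform scalar.  Size S–M. [cite: Fulton1998, §16.1 Prop. 16.1.2 (c)] -/
def GraphPullbackIsCorrAt (hE : E₀.dim = 1) : Prop :=
  ∃ γg : (pad4Anchor E₀ ⟶ pad2Anchor E₀) → complexBetti ((pad4Anchor E₀).X ⊗ (pad2Anchor E₀).X) (2 * 4),
    (∀ g, γg g ∈ algebraicClasses ((pad4Anchor E₀).X ⊗ (pad2Anchor E₀).X) 4) ∧
    ∀ μ : OrientationFamily, μ.HasPoincareDuality → ∃ t : ℂ, t ≠ 0 ∧ ∀ g,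
      corrAction μ pad4Anchor_smooth (pad2Anchor_smooth hE) (rfl : 2 * 2 + 2 * 4 = 2 * 2 + 2 * 4) (γg g) =
        t • (complexBetti.map g.hom.hom.hom (2 * 2)).hom

variable (d E₀ ψ₀) in
/-- **Clause (R2) `GraphSumTransportAt`** — THE LINEAR-ALGEBRA HEART (pencil calculus in `⋀•H¹`, no geometry):
finitely many homomorphisms `g_n : S⁴ → S² (= E₀⁴)` and complex coefficients `c_n` with
`(Σ_n c_n (g_n^* + (σ ≫ g_n)^*)) H⁴(E₀⁴) = T₀`.  Explicit solution (see the rung docstring): `g_j = (n𝟙 + ψ)^j ≫ m_Σ`,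
`j = 0…4`, `n = d + 1`, `c_j = β_j` the Lagrange coefficients isolating the eigenvalue `(n - i√d)^4` of `(n𝟙+ψ)^*`
on `H⁴(P) = ⊕_k ⋀ᵏV₊ ⊗ ⋀^{4-k}V₋` (the five eigenvalues `(n+i√d)^k (n-i√d)^{4-k}` are distinct for `n > √d`), so
that `Σ_j β_j ((n𝟙+ψ)^j)^* = Π₋` and `Π₋ ∘ m_Σ^* = ⋀⁴(pr₋ ∘ m_Σ^*|_{H¹})` with `pr₋ ∘ m_Σ^* : H¹(E₀⁴) ⥲ V₋`
(`dw_j ↦ dz_{y_j}`, `dw̄_j ↦ dz̄_{x_j}`).  Size M–L (tools: `AbelianVarietyCohomologyExteriorH1`, the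
`pullbackEigenclasses` calculus of the X1/X3 helper files). [cite: arXiv:1109.5632, §3.5 Prop. 37]
[cite: Schoen1998HodgeWeilAddendum, §10] -/
def GraphSumTransportAt : Prop :=
  ∃ (N : ℕ) (g : Fin N → (pad4Anchor E₀ ⟶ pad2Anchor E₀)) (c : Fin N → ℂ),
    (⊤ : Submodule ℂ (complexBetti (pad2Anchor E₀).X (2 * 2))).map
      (∑ n, c n • ((complexBetti.map (g n).hom.hom.hom (2 * 2)).hom +
        (complexBetti.map (pad4Swap E₀ ≫ g n).hom.hom.hom (2 * 2)).hom)) = cyFormAnchor E₀ ψ₀ d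

variable (E₀) in
/-- **Clause (R3) `SquareClauseAt`** — the square clause of `HasCorrCarrier` for `Y = S² ≅ E₀⁴`, `T_Y = ⊤`: every
rational `(4,4)`-class in `span(pr₁^*u ∪ pr₂^*v) ⊂ H⁸(Y ⊗ Y)` is algebraic — an INSTANCE of the Hodge conjecture
for `Y ⊗ Y = (S² × S²).X ≅ E₀⁸`, unconditional in the tree (`vanGeemen1994_thm43_hodgeConjectureFor` /
`MultiEllSlots.tate_hodgeConjectureFor`, degree `2·4`).  Size S–M (reassociation isogeny `(S²)² ~ E₀^{7+1}`).
[cite: vanGeemen1994HodgeAV, Thm. 4.3] [cite: MoonenZarhin1999LowDim, Cor. (3.9)] -/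
def SquareClauseAt : Prop :=
  ∀ c ∈ Submodule.span ℂ {x | ∃ u ∈ (⊤ : Submodule ℂ (complexBetti (pad2Anchor E₀).X (2 * 2))),
      ∃ v ∈ (⊤ : Submodule ℂ (complexBetti (pad2Anchor E₀).X (2 * 2))),
      x = cupProduct (show 2 * 2 + 2 * 2 = 2 * 4 from rfl)
        (complexBetti.map (CartesianMonoidalCategory.fst (pad2Anchor E₀).X (pad2Anchor E₀).X) (2 * 2) u)
        (complexBetti.map (CartesianMonoidalCategory.snd (pad2Anchor E₀).X (pad2Anchor E₀).X) (2 * 2) v)},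
    IsRationalClass c → IsOfHodgeType (4 + 4) ((pad2Anchor E₀).X ⊗ (pad2Anchor E₀).X) (2 * 4) 4 4 c →
      c ∈ algebraicClasses ((pad2Anchor E₀).X ⊗ (pad2Anchor E₀).X) 4

variable (d E₀ ψ₀) in
/-- The TRANSPORT clause of `HasCorrCarrier` at the anchor for the named carrier: an algebraic `γ ∈ Alg⁴(P ⊗ Y)` with
`γ_* H⁴(Y) = T₀` for every `μ`. -/
def CorrTransportAt (hE : E₀.dim = 1) : Prop :=
  ∃ γ : complexBetti ((pad4Anchor E₀).X ⊗ (pad2Anchor E₀).X) (2 * 4),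
    γ ∈ algebraicClasses ((pad4Anchor E₀).X ⊗ (pad2Anchor E₀).X) 4 ∧
    ∀ μ : OrientationFamily, μ.HasPoincareDuality →
      (⊤ : Submodule ℂ (complexBetti (pad2Anchor E₀).X (2 * 2))).map
        (corrAction μ pad4Anchor_smooth (pad2Anchor_smooth hE) (rfl : 2 * 2 + 2 * 4 = 2 * 2 + 2 * 4) γ) =
      cyFormAnchor E₀ ψ₀ d

/-- `map (t • L) ⊤ = map L ⊤` for `t ≠ 0`. -/
theorem map_smul_top_eq {V W : Type*} [AddCommGroup V] [Module ℂ V] [AddCommGroup W] [Module ℂ W]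
    (L : V →ₗ[ℂ] W) {t : ℂ} (ht : t ≠ 0) (U : Submodule ℂ V) : U.map (t • L) = U.map L := by
  ext w
  simp only [Submodule.mem_map, LinearMap.smul_apply]
  constructor
  · rintro ⟨v, hv, rfl⟩
    exact ⟨t • v, U.smul_mem t hv, by rw [LinearMap.map_smul]⟩
  · rintro ⟨v, hv, rfl⟩
    exact ⟨t⁻¹ • v, U.smul_mem _ hv, by rw [LinearMap.map_smul, smul_smul, mul_inv_cancel₀ ht, one_smul]⟩

/-- **(R1) + (R2) ⇒ the transport clause**: `γ := Σ_n c_n (γ_{g_n} + γ_{σ ≫ g_n})` is algebraic (a `ℂ`-combination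
of algebraic classes) and acts, for every `μ`, as `t_μ • Σ_n c_n (g_n^* + (σ ≫ g_n)^*)`, whose image of `H⁴(Y)` is
`T₀` by (R2) (`t_μ ≠ 0` does not move the image). -/
theorem corrTransportAt_of_graphs (hE : E₀.dim = 1) (h1 : GraphPullbackIsCorrAt E₀ hE)
    (h2 : GraphSumTransportAt d E₀ ψ₀) : CorrTransportAt d E₀ ψ₀ hE := by
  obtain ⟨γg, hγalg, hγact⟩ := h1
  obtain ⟨N, g, c, hsum⟩ := h2
  refine ⟨∑ n, c n • (γg (g n) + γg (pad4Swap E₀ ≫ g n)), ?_, ?_⟩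
  · exact Submodule.sum_mem _ fun n _ => Submodule.smul_mem _ _ (Submodule.add_mem _ (hγalg _) (hγalg _))
  · intro μ hμ
    obtain ⟨t, ht, hg⟩ := hγact μ hμ
    have key : corrAction μ pad4Anchor_smooth (pad2Anchor_smooth hE) (rfl : 2 * 2 + 2 * 4 = 2 * 2 + 2 * 4)
        (∑ n, c n • (γg (g n) + γg (pad4Swap E₀ ≫ g n))) =
        t • ∑ n, c n • ((complexBetti.map (g n).hom.hom.hom (2 * 2)).hom +
          (complexBetti.map (pad4Swap E₀ ≫ g n).hom.hom.hom (2 * 2)).hom) := by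
      rw [map_sum, Finset.smul_sum]
      refine Finset.sum_congr rfl fun n _ => ?_
      rw [map_smul, map_add, hg, hg, ← smul_add, smul_comm]
    rw [key, map_smul_top_eq _ ht, hsum]

/-- **The rung from the three named clauses** (kernel-checked): with `T := T₀ = cyFormAnchor` (settled CY form),
`Y := S² ≅ E₀⁴` (`m = 4`), `T_Y := ⊤` — `dim = 70` (`finrank_top_four_of_dim_four`), rational- and pure-type-spanned
(`top_le_span_isRationalClass`, `top_le_span_pureType`, landed p601299) — the square clause (R3) and the transport
clause from (R1)+(R2). -/
theorem correspondenceCarrier_at_CM_point_of_clauses (hd : 0 < d) (hE : E₀.dim = 1)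
    (hψ : ψ₀ ≫ ψ₀ = -(d • 𝟙 E₀)) (h1 : GraphPullbackIsCorrAt E₀ hE) (h2 : GraphSumTransportAt d E₀ ψ₀)
    (h3 : SquareClauseAt E₀) :
    ∃ T : Submodule ℂ (complexBetti (pad4Anchor E₀).X (2 * 2)),
      IsCYFormAt d (pad4Anchor E₀) (pad4Action E₀ ψ₀) T ∧ HasCorrCarrier (pad4Anchor E₀) T := by
  obtain ⟨γ, hγ, hγT⟩ := corrTransportAt_of_graphs hE h1 h2
  refine ⟨cyFormAnchor E₀ ψ₀ d, isCYFormAt_cyFormAnchor hd hE hψ, 4, (pad2Anchor E₀).X, pad2Anchor_smooth hE, ⊤, γ,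
    Summit.HodgeConjecture.HodgeConjecture.Theorems.CYFormCarrier.finrank_top_four_of_dim_four (pad2Anchor_dim hE),
    Summit.HodgeConjecture.HodgeConjecture.Theorems.CYFormCarrier.top_le_span_isRationalClass (pad2Anchor_smooth hE) _,
    Summit.HodgeConjecture.HodgeConjecture.Theorems.CYFormCarrier.top_le_span_pureType (pad2Anchor_smooth hE) _,
    h3, hγ, ?_⟩
  intro μ hμ
  exact hγT μ hμ

/-- **`stub_correspondenceCarrier_at_CM_point_of_clauses`** — the rung, for all `d` and all CM data, from the three
clauses supplied pointwise (the prover's entry point: prove (R1), (R2), (R3) and apply this). -/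
theorem stub_correspondenceCarrier_at_CM_point_of_clauses
    (h : ∀ d : ℕ, 0 < d → ∀ (E₀ : AbelianVariety ℂ) (ψ₀ : E₀ ⟶ E₀) (hE : E₀.dim = 1), ψ₀ ≫ ψ₀ = -(d • 𝟙 E₀) →
      GraphPullbackIsCorrAt E₀ hE ∧ GraphSumTransportAt d E₀ ψ₀ ∧ SquareClauseAt E₀) :
    ∀ d : ℕ, 0 < d → ∀ (E₀ : AbelianVariety ℂ) (ψ₀ : E₀ ⟶ E₀), E₀.dim = 1 → ψ₀ ≫ ψ₀ = -(d • 𝟙 E₀) →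
      ∃ T : Submodule ℂ (complexBetti (pad4Anchor E₀).X (2 * 2)),
        IsCYFormAt d (pad4Anchor E₀) (pad4Action E₀ ψ₀) T ∧ HasCorrCarrier (pad4Anchor E₀) T := by
  intro d hd E₀ ψ₀ hE hψ
  obtain ⟨h1, h2, h3⟩ := h d hd E₀ ψ₀ hE hψ
  exact correspondenceCarrier_at_CM_point_of_clauses hd hE hψ h1 h2 h3

/-- The rung packaged with the anchor's Weil-type certificate: for every `d > 0` SOME split CM `ℚ(√-d)`-eightfold of
dimension `2·4` with `ψ² = -d` carries a CY form with a correspondence carrier (from STUB 3 and `exists_anchor`). -/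
theorem exists_cm_eightfold_with_corrCarrier_of_stub
    (h : ∀ d : ℕ, 0 < d → ∀ (E₀ : AbelianVariety ℂ) (ψ₀ : E₀ ⟶ E₀), E₀.dim = 1 → ψ₀ ≫ ψ₀ = -(d • 𝟙 E₀) →
      ∃ T : Submodule ℂ (complexBetti (pad4Anchor E₀).X (2 * 2)),
        IsCYFormAt d (pad4Anchor E₀) (pad4Action E₀ ψ₀) T ∧ HasCorrCarrier (pad4Anchor E₀) T)
    (d : ℕ) (hd : 0 < d) :
    ∃ (P : AbelianVariety ℂ) (ψ : P ⟶ P), P.dim = 2 * 4 ∧ ψ ≫ ψ = -(d • 𝟙 P) ∧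
      ∃ T : Submodule ℂ (complexBetti P.X (2 * 2)), IsCYFormAt d P ψ T ∧ HasCorrCarrier P T := by
  obtain ⟨E₀, ψ₀, hE, hψ, hdim, hsq⟩ := exists_anchor d hd
  exact ⟨pad4Anchor E₀, pad4Action E₀ ψ₀, hdim, hsq, h d hd E₀ ψ₀ hE hψ⟩

end RungReduction

/-! ## §4 The pivoted cone in one term (the route's items after R13.15; `closes` is the gate-written deciding
theorem of `Theses/CYFormCasimir.lean`) -/

/-- The rung IS X1corr's ∃-conclusion at the anchor (definitional). -/
theorem rung_eq_X1corr_conclusion_at_anchor (d : ℕ) (E₀ : AbelianVariety ℂ) (ψ₀ : E₀ ⟶ E₀) :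
    (∃ T : Submodule ℂ (complexBetti (pad4Anchor E₀).X (2 * 2)),
        IsCYFormAt d (pad4Anchor E₀) (pad4Action E₀ ψ₀) T ∧ HasCorrCarrier (pad4Anchor E₀) T) ↔
      (∃ T : Submodule ℂ (complexBetti (pad4Anchor E₀).X (2 * 2)),
        IsCYFormAt d (pad4Anchor E₀) (pad4Action E₀ ψ₀) T ∧ HasCorrCarrier (pad4Anchor E₀) T) :=
  Iff.rfl

/-- X1corr from STUB 1 and the corr-carrier step, and rung H2 from the pivoted item set through the route's own
deciding theorem `CYFormCasimir.closes` — the whole cone in one term (hypotheses explicit; nothing is proved about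
them here). -/
theorem weilSixfolds_of_pivoted_items (hC : CorrCarrierOfCYFormEight) (h2 : Summit.HodgeConjecture.HodgeConjecture.Theses.CYFormCasimir.CasimirCorrTransportEight)
    (h3 : Summit.HodgeConjecture.HodgeConjecture.Theses.CYFormCasimir.CYFormSquarePrinciple)
    (h4 : Summit.HodgeConjecture.HodgeConjecture.Theses.CYFormCasimir.GeneralToAllSplitEightOfReach)
    (h5 : Summit.HodgeConjecture.HodgeConjecture.Theses.CYFormCasimir.ReachHyperbolic) :
    Summit.HodgeConjecture.HodgeConjecture.Theses.SevenfoldWeilCensus.WeilSixfolds :=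
  Summit.HodgeConjecture.HodgeConjecture.Theses.CYFormCasimir.closes
    (cyFormCorrCarrierEight_iff.mpr (CYFormCorrCarrierEight_of stub_cyform_exists hC)) h2 h3 h4 h5

/-! ## §5 STUB 4 — the F2(α) RUNG on PRODUCTS OF WEIL-TYPE FOURFOLDS `A = X × X′` (v5.2, tribunal-w
hodge-trib-w-cyf g0, 2026-08-28; J ROUND 2 fb38ea6ef7abd5a4 §(T3) grant condition F2(α); PLAN-ONLY — one more `sorry`,
NOT a binder of `CYFormCorrCarrierEight_of_stubs`; the n = 2 shadow clause `K3FormCorrCarrierFour` is a `def`, not a stub)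

HONEST FRAMING (repeated for §5). Nothing below proves STUB 4, X1corr, E8 on products, rung H2 or HC; the Markman named
facts of `Literature/…/WeilFourfoldsDiscOnePowers`, `…/WeilClassesFourfolds` are NOT assumed or used here; HC_CM is HELD
and untouched.  The only theorems of §5 are packaging identities (`dim`, `φ²`, instantiation of X1corr at a product). -/

section ProductRung

variable (X X' : AbelianVariety ℂ) (φ : X ⟶ X) (φ' : X' ⟶ X')

/-- The product `K`-action `φ × φ′ := prodLift (fst ≫ φ) (snd ≫ φ′)` on `X × X′` — the literal shape of
`WeilTypeLadder.splitEightfolds_fourfoldProdFourfold_of_markman2023` (compatible with `φ`, `φ′` under the projections).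
[cite: Markman2025SurveySecant, §11.5 Step 2] [cite: Schoen1998HodgeWeilAddendum, §10] -/
abbrev prodWeilAct : X.prod X' ⟶ X.prod X' :=
  AbelianVariety.prodLift (AbelianVariety.fst X X' ≫ φ) (AbelianVariety.snd X X' ≫ φ')

variable {X X' φ φ'}

/-- `dim (X × X′) = 2·4` for two abelian FOURFOLDS: the product is an eightfold (X1corr's binder `A.dim = 2 * 4`). -/
theorem prodWeil_dim (hX : X.dim = 2 * 2) (hX' : X'.dim = 2 * 2) : (X.prod X').dim = 2 * 4 :=
  (dim_prod_eq_two_mul hX hX').trans (by norm_num)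

/-- `(φ × φ′) ≫ (φ × φ′) = -d` (X1corr's binder `φ ≫ φ = -(d • 𝟙 A)` for the product action). -/
theorem prodWeilAct_comp_self {d : ℕ} (hφ : φ ≫ φ = -(d • 𝟙 X)) (hφ' : φ' ≫ φ' = -(d • 𝟙 X')) :
    prodWeilAct X X' φ φ' ≫ prodWeilAct X X' φ φ' = -(d • 𝟙 (X.prod X')) :=
  prodLift_comp_self_eq_neg_nsmul hφ hφ'

/-- **`IsK3FormAt d X φ T₁` — the n = 2 SHADOW of `IsCYFormAt`** (same five clauses in degree `2 = 2·1`, exponent 2,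
rank `6 = C(4,2)`): `T₁ ⊗ ℂ ⊂ ⋀²V₊ ⊕ ⋀²V₋` (the `(x ± y i√d)²`-eigenclasses of `(x𝟙 + yφ)^*` on `H²`; their sum is
Lombardo's 12-dimensional `T = ⋀²_K H¹(X) ⊂ H²(X, ℚ)`, `h^{2,0}(T) = 2`), `T₁ ∩ ⋀²V₊ = 0`, `dim T₁ = 6`, `T₁` spanned by
its rational classes and by its pure-type classes — i.e. `T₁` is (the complexification of) a rational K3-type sub-Hodge
structure `(1,4,1)` of `T` projecting isomorphically onto both `⋀²V_±`.  For a Hodge-general Weil fourfold such a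
`T₁` exists iff the discriminant is trivial (`T ≅ T₁^{⊕2}`, `End_Hod(T) ≅ M₂(ℚ)`; no K3-type copy is `K`-stable, whence
`T₁ ∩ ⋀²V₊ = 0` for every copy). [cite: arXiv:2607.18341, Thm. 1.8 (c)–(d) (Lombardo) and Prop. 1.11]
[cite: arXiv:1109.5632, §2.4.2] -/
def IsK3FormAt (d : ℕ) (X : AbelianVariety ℂ) (φ : X ⟶ X) (T₁ : Submodule ℂ (complexBetti X.X (2 * 1))) : Prop :=
  T₁ ≤ pullbackEigenclasses X φ (2 * 1) (fun x y => ((x : ℂ) + (y : ℂ) * Complex.I * (Real.sqrt d : ℂ)) ^ 2) ⊔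
      pullbackEigenclasses X φ (2 * 1) (fun x y => ((x : ℂ) - (y : ℂ) * Complex.I * (Real.sqrt d : ℂ)) ^ 2) ∧
    T₁ ⊓ pullbackEigenclasses X φ (2 * 1) (fun x y => ((x : ℂ) + (y : ℂ) * Complex.I * (Real.sqrt d : ℂ)) ^ 2) = ⊥ ∧
    Module.finrank ℂ T₁ = 6 ∧
    T₁ ≤ Submodule.span ℂ {c | c ∈ T₁ ∧ IsRationalClass c} ∧
    T₁ ≤ Submodule.span ℂ {c | c ∈ T₁ ∧ ∃ p q : ℕ, p + q = 2 ∧ IsOfHodgeType (2 * 2) X.X (2 * 1) p q c}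

/-- **`HasCorrCarrierTwo X T₁` — the rank-6, degree-2 SHADOW of `HasCorrCarrier`** (same clause list with `70 ↦ 6`,
`H⁴ ↦ H²`, square clause = every rational `(2,2)`-class of `span(pr₁^*T_Y ∪ pr₂^*T_Y) ⊂ H⁴(Y ⊗ Y)` algebraic): a smooth
projective `Y` (dim `m`), `T_Y ⊂ H²(Y)` of dimension 6 spanned by rational and by pure-type classes, an ALGEBRAIC class
`γ ∈ Alg^m(X.X ⊗ Y)` with `γ_* T_Y = T₁` for every orientation family with Poincaré duality (`corrAction`, first
factor receives).  The van Geemen–Rapagnetta carrier of a very general split Weil fourfold is of this shape with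
`Y = 𝒳` a projective hyperkähler SIXFOLD of K3^[3] type (`m = 6`), `T_Y = T_{𝒳,ℚ}` its 6-dimensional transcendental
Hodge structure, `γ` = the (transposed, closed) graph of `X ~ B ⤏ K(B) ⊂ 𝒳`. [cite: arXiv:2607.18341, Thm. 0.2 and §1.14]
[cite: Fulton1998, §16.1 Def. 16.1.2] [cite: VoisinHodgeII2003, proof of Thm. 10.17 (10.7)] -/
def HasCorrCarrierTwo (X : AbelianVariety ℂ) (T₁ : Submodule ℂ (complexBetti X.X (2 * 1))) : Prop :=
  ∃ (m : ℕ) (Y : SchemeOver ℂ) (hY : IsSmoothProjective m Y) (TY : Submodule ℂ (complexBetti Y (2 * 1)))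
    (γ : complexBetti (X.X ⊗ Y) (2 * m)),
    Module.finrank ℂ TY = 6 ∧
    TY ≤ Submodule.span ℂ {c | c ∈ TY ∧ IsRationalClass c} ∧
    TY ≤ Submodule.span ℂ {c | c ∈ TY ∧ ∃ p q : ℕ, p + q = 2 ∧ IsOfHodgeType m Y (2 * 1) p q c} ∧
    (∀ c ∈ Submodule.span ℂ {x | ∃ u ∈ TY, ∃ v ∈ TY, x = cupProduct (show 2 * 1 + 2 * 1 = 2 * 2 from rfl)
        (complexBetti.map (CartesianMonoidalCategory.fst Y Y) (2 * 1) u)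
        (complexBetti.map (CartesianMonoidalCategory.snd Y Y) (2 * 1) v)},
      IsRationalClass c → IsOfHodgeType (m + m) (Y ⊗ Y) (2 * 2) 2 2 c → c ∈ algebraicClasses (Y ⊗ Y) 2) ∧
    γ ∈ algebraicClasses (X.X ⊗ Y) m ∧
    ∀ μ : OrientationFamily, μ.HasPoincareDuality →
      TY.map (corrAction μ (AbelianVariety.isSmoothProjective_holds (A := X) : IsSmoothProjective X.dim X.X) hY
        (rfl : 2 * 1 + 2 * m = 2 * 1 + 2 * m) γ) = T₁

/-- **`K3FormCorrCarrierFour` — the n = 2 SHADOW OF X1corr and the FIRST CLAUSE of STUB 4's technique** (a named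
statement, NOT a registered stub): every Hodge-general split `ℚ(√-d)`-Weil FOURFOLD carries a K3 form `T₁` with a
rank-6 correspondence carrier.  IN PRINT: for a VERY GENERAL split fourfold this is van Geemen–Rapagnetta 2026 with the
GENUINE carrier `(𝒳, T_{𝒳,ℚ}, [Γ̄ᵗ])` (Thm. 0.2: `K(B) ⊂ 𝒳`, `𝒳` projective HK of K3^[3] type with `dim T_𝒳 = 6`;
§1.14: the pull-back is an injection of Hodge structures `T_{𝒳,ℚ} ↪ T`, image a K3-type copy `T₁`), the square clause
on `𝒳 × 𝒳` holding because the only rational `(2,2)`-classes in `span(T_𝒳 ⊠ T_𝒳)` are the multiples of the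
`T_𝒳`-component of the Beauville–Bogomolov class `[q_𝒳⁻¹] ∈ H²(𝒳) ⊗ H²(𝒳)` (MT(`T_𝒳`) = SO(q), §1.13), which is
algebraic by the Lefschetz standard conjecture for K3^[n]-type manifolds (Charles–Markman Thm 1.1 / Cor 1.2: `Λ`, hence the
inverse Lefschetz pairing on `H²`, is algebraic; on `T_𝒳 ⊥ NS` it is `∝ q⁻¹` by the Fujiki relation) — and for EVERY
Hodge-general split fourfold it follows from
Markman 2023 Thm 1.3 + FFT for `SL₄` on `H^*(X × X)` via the trivial carrier `(X, T₁, π_{T₁})`; NEITHER is a tree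
theorem (E4 is the NAMED FACT `Markman2023_weilClasses_algebraic_discOneWeilFourfold`).  Why it might fail AS A PLAN:
Thm. 0.2 is deformation-theoretic and stated for very general `B′` only; the K3-type copies of `T` form a pencil
`P¹(ℚ)` and the one realised by `𝒳` need not be a preferred one (Prop. 1.11 relates any two).
[cite: arXiv:2607.18341, Thm. 0.2, Thm. 1.8, Prop. 1.11, §1.13–§1.15] [cite: arXiv:1009.0413, Thm. 1.1 and Cor. 1.2]
[cite: Markman2023GeneralizedKummers, Theorem 1.3] [cite: arXiv:1109.5632, §2.4.2] -/
def K3FormCorrCarrierFour : Prop :=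
  ∀ d : ℕ, 0 < d → ∀ (X : AbelianVariety ℂ) (φ : X ⟶ X) (e : ProjectiveEmbedding X.X)
    (a : complexBetti (projectiveSpace e.n ℂ) 2), X.dim = 2 * 2 → φ ≫ φ = -(d • 𝟙 X) → IsRationalClass a → a ≠ 0 →
    IsHyperbolicWeilType X φ 2 (symH d φ e a) →
    Literature.AlgebraicGeometry.VanGeemen1994.HasHodgeGroupSU X φ 2 d (symH d φ e a) →
    ∃ T₁ : Submodule ℂ (complexBetti X.X (2 * 1)), IsK3FormAt d X φ T₁ ∧ HasCorrCarrierTwo X T₁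

/-- **STUB 4 — THE F2(α) RUNG `stub_corrCarrier_at_weilFourfoldProduct` (BC5 / tribunal T3, PLAN-ONLY; J ROUND 2
fb38ea6ef7abd5a4 grant condition F2(α))**: for every `d > 0` and every PAIR `(X, φ)`, `(X′, φ′)` of Hodge-general split
`ℚ(√-d)`-Weil abelian FOURFOLDS (`dim = 2·2`, `φ² = φ′² = -d`, hyperbolic for the symmetrised hyperplane classes,
`Hg = SU(2,2)` each — exactly X1corr's binders at `n = 2`, as in `WeilTypeLadder.splitEightfolds_fourfoldProdFourfold_of_markman2023`),
the ∃-conclusion of the crux X1corr (`CYFormCasimir.CYFormCorrCarrierEight`, the route decl) VERBATIM at the product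
eightfold `(A, ψ) = (X × X′, φ × φ′)` (`prodWeil_dim`, `prodWeilAct_comp_self`): a CY form `T` WITH A CORRESPONDENCE
CARRIER, `∃ T, IsCYFormAt d A ψ T ∧ HasCorrCarrier A T`.  The rung sits BESIDE the crux (`productRung_conclusion_of_X1corr`:
X1corr would give it only under `HasHodgeGroupSU (X × X′) ψ 4 …`, which FAILS — `Hg(X × X′) ⊂ SU(2,2) × SU(2,2) ⊊ SU(4,4)`).

NAMED TECHNIQUE (the planned NON-trivial carrier; first clause typed as `K3FormCorrCarrierFour`).
(i) KÜNNETH SPLIT OF THE CY FORM.  `W_A = W_X ⊕ W_X′` is an orthogonal sum of split hermitian `K`-spaces, so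
`⋀⁴_K W_A = ⊕_{k=0}^{4} ⋀^k_K W_X ⊗_K ⋀^{4-k}_K W_X′` and the FL13 Hodge star of `A` is the graded tensor `± ⋆_X ⊗ ⋆_X′`;
hence the CY form (the `⋆`-fixed `ℚ`-form, `IsCYFormAt`; it exists on products although `cyFormExists_eight`'s `hSU`
fails there) splits over `ℚ` along the Künneth decomposition of `H⁴(X × X′)`: `T = T₀₄ ⊕ T₁₃ ⊕ T₂₂ ⊕ T₃₁ ⊕ T₄₀`, ranks
`(1,16,36,16,1)`, Hodge numbers `T₂₂ : (1,8,18,8,1)` (it carries `T^{4,0}`), `T₁₃, T₃₁ : (0,4,8,4,0)`, `T₀₄, T₄₀ : (0,0,1,0,0)`,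
and `T₂₂ = π₂₂(T₁(X) ⊗ T₁(X′))` for the K3 forms `T₁` of the factors (`IsK3FormAt`), where `π₂₂` — the projector of
`H²(X) ⊗ H²(X′)` onto its `(⋀²V₊ ⊗ ⋀²V′₊) ⊕ (⋀²V₋ ⊗ ⋀²V′₋)`-part — is a `ℚ`-polynomial in the graphs of
`(x𝟙 + yφ) × (x′𝟙 + y′φ′)` (Lagrange interpolation on the eigenvalues `(x + yi√d)^a (x - yi√d)^b`, the calculus of R2
`GraphSumTransportAt`), hence an ALGEBRAIC self-correspondence of `A`, and `π₂₂ : T₁(X) ⊗ T₁(X′) ⥲ T₂₂` (decomposable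
tensors `x ⊗ x′ + ⋆x ⊗ ⋆x′` span; `36 = 36`).
(ii) THE CARRIER.  K3 piece: `Y₂₂ = 𝒳 × 𝒳′`, the van Geemen–Rapagnetta K3^[3]-type hyperkähler SIXFOLDS of the two
factors (`K3FormCorrCarrierFour` twice), `T_{Y₂₂} = T_{𝒳,ℚ} ⊠ T_{𝒳′,ℚ} ⊂ H²(𝒳) ⊗ H²(𝒳′) ⊂ H⁴(𝒳 × 𝒳′)` (rank 36,
`(1,4,1) ⊗ (1,4,1) = (1,8,18,8,1)`), `γ₂₂ = π₂₂ ∘ (γ_X ⊠ γ_X′)` (exterior product of the two graph correspondences composed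
with the algebraic projector: algebraic, and `(γ₂₂)_* T_{Y₂₂} = T₂₂` by (i)); abelian piece: `T₀₄ ⊕ T₁₃ ⊕ T₃₁ ⊕ T₄₀`
(rank 34, no `(4,0)`-part) is carried by `A` itself through the algebraic Künneth ⊗ `K`-isotypic projectors (Künneth and
Lefschetz components are algebraic on abelian varieties — Lieberman/Kleiman — and the `K`-isotypic cut is Lagrange in
graphs again); assembled on ONE equidimensional `Y = (𝒳 × 𝒳′) ⊔ (A × ℙ⁴)` (`m = 12`; or `𝒳 × 𝒳′ × A`, `m = 20`) with
`T_Y = T_{Y₂₂} ⊕ pr_A^*(T₀₄ ⊕ T₁₃ ⊕ T₃₁ ⊕ T₄₀)` (rank 70, rational- and pure-type-spanned) and `γ = γ₂₂ + [Γᵗ_{pr_A}] ∪ [pt]`.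
(iii) SQUARE CLAUSE on `Y × Y`.  `γ_* : T_Y ⥲ T` is an isomorphism of Hodge structures, so for a Hodge-general pair the
rational `(4,4)`-classes of `span(pr₁^*T_Y ∪ pr₂^*T_Y)` are the `SL₄ × SL₄`-invariants of `T ⊗ T ≅ ⊕_{k,l} (⋀^kV ⊗ ⋀^lV) ⊗
(⋀^{4-k}V′ ⊗ ⋀^{4-l}V′)`: by the FFT exactly SEVEN lines, one for each `(k,l)` with `k + l ≡ 0 (mod 4)` — the line in
`T₂₂ ⊗ T₂₂` (`↔ q_𝒳⁻¹ ⊗ q_{𝒳′}⁻¹`, the `T`-components of the Beauville–Bogomolov classes: algebraic on `(𝒳 × 𝒳′)²` by the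
Lefschetz standard conjecture for K3^[n]-type manifolds, Charles–Markman Thm 1.1, with MT(`T_𝒳`) = SO(q), vG–R §1.13), the
two determinant lines in `T₁₃ ⊗ T₃₁`, `T₃₁ ⊗ T₁₃` and the four products of the Hodge LINES `T₀₄`, `T₄₀` (all on `A × A`:
Markman 2023 + FFT, print, not tree); NO invariant mixes `T₂₂` with another piece (`⋀²V ⊗ ⋀^kV` has an `SL₄`-invariant
only for `k = 2`), so the two components of `Y` do not interact in the square clause.

WHY OUTSIDE S's KNOWN REGIME («modulo print-known regime», J F2(α)).  The rung's objects are the eightfold `X × X′`, the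
16-fold `(X × X′)²` and hyperkähler sixfolds; on `X × X′` neither E8 nor HC in any codimension ≥ 2 is a TREE theorem — the
tree has only `WeilTypeLadder.splitEightfolds_fourfoldProdFourfold_of_markman2023` /`…_of_markman2025Fourfold`, i.e. E8
on the product locus MODULO the NAMED FACTS `Markman2023_weilClasses_algebraic_discOneWeilFourfold` /
`Markman2025_weilClasses_algebraic_abelianFourfold` — unlike the E₀-power anchor of STUB 3 (`tate_hodgeConjectureFor_multiPowSucc`).
IN PRINT the statement is TRUE for every such pair: HC for all powers of `X × X′` follows from Markman 2023 Thm 1.3 (both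
factors) + the FFT for `SL₄ × SL₄` (Hodge ring of `(X × X′)^k` generated by divisors and pull-backs of the factors' Weil
classes along homomorphisms) + Lefschetz (1,1), whence the TRIVIAL carrier `(A, T, π_T)` also satisfies `HasCorrCarrier` —
so, exactly as J ruled for (α), this is a PLAN-ONLY witness «modulo print-known regime» whose credit is the NAMED
non-trivial carrier (ii), the first geometric realisation of the weight-4 CY piece `T₂₂ ∋ T^{4,0}` outside abelian varieties.
WHY IT MIGHT FAIL (the technique, not the statement): vG–R Thm. 0.2 is proved for VERY GENERAL split fourfolds only
(deformation-theoretic existence of `𝒳 ⊃ K(B)`), so a Hodge-general but special pair needs a specialisation step for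
`γ₂₂`; the sign/normalisation in `⋆_A = ± ⋆_X ⊗ ⋆_X′` and the choice of the K3-type copy `T₁` inside Lombardo's pencil
must match the FL13 fixed form (Prop. 1.11); (iii) on `(𝒳 × 𝒳′)²` uses MT(`T_𝒳`) = SO (very general again).
Size L (typing: exterior product of `corrAction`, disjoint-union / triple-product carriers, Lagrange projectors ×2).
Dead lines honoured: not an E₀-power (J T3 regime test), not clause-exact (J-NOGO void for correspondences anyway), not a
Dolgachev / Cynk–Hulek CY candidate (SXZ test does not arise: the carrier is HK × HK ⊔ abelian, named, in print).
[cite: arXiv:2607.18341, Thm. 0.2, Thm. 0.3, Thm. 1.8, Prop. 1.11, §1.13–§1.15] [cite: arXiv:1109.5632, §2.4.2 and Prop. 37]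
[cite: arXiv:1009.0413, Thm. 1.1 and Cor. 1.2] [cite: Markman2023GeneralizedKummers, Theorem 1.3] [cite: Markman2025SurveySecant, Thm. 1.2, §11.5 Step 2 and §12]
[cite: Schoen1998HodgeWeilAddendum, §10] [cite: Kleiman1968, Thm. 2A9–2A11 (Lieberman)] [cite: Fulton1998, §16.1 Prop. 16.1.1–16.1.2]
[cite: vanGeemen1994HodgeAV, Thm. 6.12 and Lemma 5.2] [cite: MoonenZarhin1999LowDim, Cor. (3.9)] -/
theorem stub_corrCarrier_at_weilFourfoldProduct :
    ∀ d : ℕ, 0 < d → ∀ (X X' : AbelianVariety ℂ) (φ : X ⟶ X) (φ' : X' ⟶ X')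
      (e : ProjectiveEmbedding X.X) (a : complexBetti (projectiveSpace e.n ℂ) 2)
      (e' : ProjectiveEmbedding X'.X) (a' : complexBetti (projectiveSpace e'.n ℂ) 2),
      X.dim = 2 * 2 → X'.dim = 2 * 2 → φ ≫ φ = -(d • 𝟙 X) → φ' ≫ φ' = -(d • 𝟙 X') →
      IsRationalClass a → a ≠ 0 → IsRationalClass a' → a' ≠ 0 →
      IsHyperbolicWeilType X φ 2 (symH d φ e a) →
      Literature.AlgebraicGeometry.VanGeemen1994.HasHodgeGroupSU X φ 2 d (symH d φ e a) →
      IsHyperbolicWeilType X' φ' 2 (symH d φ' e' a') →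
      Literature.AlgebraicGeometry.VanGeemen1994.HasHodgeGroupSU X' φ' 2 d (symH d φ' e' a') →
      ∃ T : Submodule ℂ (complexBetti (X.prod X').X (2 * 2)),
        IsCYFormAt d (X.prod X') (prodWeilAct X X' φ φ') T ∧ HasCorrCarrier (X.prod X') T := by
  sorry

/-- **The rung IS X1corr's conclusion at the product, and X1corr does NOT hand it over**: instantiating the crux
(route decl, unfolded by `cyFormCorrCarrierEight_iff`) at `(A, ψ) = (X × X′, φ × φ′)` yields STUB 4's conclusion — but
only under the product's OWN Hodge-generality binders `IsHyperbolicWeilType (X × X′) ψ 4 h` and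
`HasHodgeGroupSU (X × X′) ψ 4 d h`, and the latter FAILS for products (`Hg(X × X′) ⊂ SU(2,2) × SU(2,2) ⊊ SU(4,4)`).  So STUB 4 is a
rung BESIDE the crux (signature test), exactly like STUB 3; the binders `dim = 2·4` and `ψ² = -d` are discharged here. -/
theorem productRung_conclusion_of_X1corr
    (h1 : Summit.HodgeConjecture.HodgeConjecture.Theses.CYFormCasimir.CYFormCorrCarrierEight)
    {d : ℕ} (hd : 0 < d) (hX : X.dim = 2 * 2) (hX' : X'.dim = 2 * 2)
    (hφ : φ ≫ φ = -(d • 𝟙 X)) (hφ' : φ' ≫ φ' = -(d • 𝟙 X'))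
    (e : ProjectiveEmbedding (X.prod X').X) {a : complexBetti (projectiveSpace e.n ℂ) 2}
    (ha : IsRationalClass a) (ha0 : a ≠ 0)
    (hhyp : IsHyperbolicWeilType (X.prod X') (prodWeilAct X X' φ φ') 4 (symH d (prodWeilAct X X' φ φ') e a))
    (hSU : Literature.AlgebraicGeometry.VanGeemen1994.HasHodgeGroupSU (X.prod X') (prodWeilAct X X' φ φ') 4 d
      (symH d (prodWeilAct X X' φ φ') e a)) :
    ∃ T : Submodule ℂ (complexBetti (X.prod X').X (2 * 2)),
      IsCYFormAt d (X.prod X') (prodWeilAct X X' φ φ') T ∧ HasCorrCarrier (X.prod X') T :=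
  cyFormCorrCarrierEight_iff.mp h1 d hd (X.prod X') (prodWeilAct X X' φ φ') e a (prodWeil_dim hX hX')
    (prodWeilAct_comp_self hφ hφ') ha ha0 hhyp hSU

/-- **STUB 4 packaged with the product's Weil-type certificate**: for every pair of Hodge-general split `ℚ(√-d)`-Weil
fourfolds the product is a split `ℚ(√-d)`-eightfold of dimension `2·4` with `ψ² = -d` carrying a CY form with a
correspondence carrier (from STUB 4, `prodWeil_dim`, `prodWeilAct_comp_self`) — the F2(α) companion of
`exists_cm_eightfold_with_corrCarrier_of_stub`. -/
theorem product_eightfold_with_corrCarrier_of_stub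
    (h : ∀ d : ℕ, 0 < d → ∀ (X X' : AbelianVariety ℂ) (φ : X ⟶ X) (φ' : X' ⟶ X')
      (e : ProjectiveEmbedding X.X) (a : complexBetti (projectiveSpace e.n ℂ) 2)
      (e' : ProjectiveEmbedding X'.X) (a' : complexBetti (projectiveSpace e'.n ℂ) 2),
      X.dim = 2 * 2 → X'.dim = 2 * 2 → φ ≫ φ = -(d • 𝟙 X) → φ' ≫ φ' = -(d • 𝟙 X') →
      IsRationalClass a → a ≠ 0 → IsRationalClass a' → a' ≠ 0 →
      IsHyperbolicWeilType X φ 2 (symH d φ e a) →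
      Literature.AlgebraicGeometry.VanGeemen1994.HasHodgeGroupSU X φ 2 d (symH d φ e a) →
      IsHyperbolicWeilType X' φ' 2 (symH d φ' e' a') →
      Literature.AlgebraicGeometry.VanGeemen1994.HasHodgeGroupSU X' φ' 2 d (symH d φ' e' a') →
      ∃ T : Submodule ℂ (complexBetti (X.prod X').X (2 * 2)),
        IsCYFormAt d (X.prod X') (prodWeilAct X X' φ φ') T ∧ HasCorrCarrier (X.prod X') T)
    {d : ℕ} (hd : 0 < d) (hX : X.dim = 2 * 2) (hX' : X'.dim = 2 * 2)
    (hφ : φ ≫ φ = -(d • 𝟙 X)) (hφ' : φ' ≫ φ' = -(d • 𝟙 X'))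
    (e : ProjectiveEmbedding X.X) {a : complexBetti (projectiveSpace e.n ℂ) 2} (ha : IsRationalClass a) (ha0 : a ≠ 0)
    (e' : ProjectiveEmbedding X'.X) {a' : complexBetti (projectiveSpace e'.n ℂ) 2} (ha' : IsRationalClass a')
    (ha0' : a' ≠ 0) (hhyp : IsHyperbolicWeilType X φ 2 (symH d φ e a))
    (hSU : Literature.AlgebraicGeometry.VanGeemen1994.HasHodgeGroupSU X φ 2 d (symH d φ e a))
    (hhyp' : IsHyperbolicWeilType X' φ' 2 (symH d φ' e' a'))
    (hSU' : Literature.AlgebraicGeometry.VanGeemen1994.HasHodgeGroupSU X' φ' 2 d (symH d φ' e' a')) :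
    (X.prod X').dim = 2 * 4 ∧ prodWeilAct X X' φ φ' ≫ prodWeilAct X X' φ φ' = -(d • 𝟙 (X.prod X')) ∧
      ∃ T : Submodule ℂ (complexBetti (X.prod X').X (2 * 2)),
        IsCYFormAt d (X.prod X') (prodWeilAct X X' φ φ') T ∧ HasCorrCarrier (X.prod X') T :=
  ⟨prodWeil_dim hX hX', prodWeilAct_comp_self hφ hφ',
    h d hd X X' φ φ' e a e' a' hX hX' hφ hφ' ha ha0 ha' ha0' hhyp hSU hhyp' hSU'⟩

/-- The rung IS X1corr's ∃-conclusion at the product point (definitional, cf. `rung_eq_X1corr_conclusion_at_anchor`). -/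
theorem productRung_eq_X1corr_conclusion_at_product (d : ℕ) :
    (∃ T : Submodule ℂ (complexBetti (X.prod X').X (2 * 2)),
        IsCYFormAt d (X.prod X') (prodWeilAct X X' φ φ') T ∧ HasCorrCarrier (X.prod X') T) ↔
      (∃ T : Submodule ℂ (complexBetti (X.prod X').X (2 * 2)),
        IsCYFormAt d (X.prod X') (AbelianVariety.prodLift (AbelianVariety.fst X X' ≫ φ) (AbelianVariety.snd X X' ≫ φ')) T ∧
          HasCorrCarrier (X.prod X') T) :=
  Iff.rfl

end ProductRung

/-! ## §6 STUB 5 — the F2(α′) RUNG on TWISTED SQUARES `A = X × X̄ = (X × X, φ × (−φ))` of ONE Hodge-general Weil-type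
FOURFOLD (v5.3, tribunal-w hodge-trib-w-cyf g2, 2026-08-28; J ROUND 2 fb38ea6ef7abd5a4 §(T3) F2(α) «modulo print-known regime»;
APPEND-ONLY — every v5.2 declaration is byte-identical; ONE more `sorry` (STUB 5), NOT a binder of `CYFormCorrCarrierEight_of_stubs`)

WHAT §6 ADDS, AND WHY.  STUB 4 (§5) is the F2(α) rung on products `X × X′` with the NAMED carrier «K3^[3] × K3^[3] ⊔ abelian»
— kernel-remote (J r2a: not a prover target).  §6 files the (α)-regime rung CLOSEST TO THE KERNEL: the anti-diagonal member
`X′ = X̄ := (X, −φ)` of the product family, where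
* the CY form is EXPLICIT and its five `IsCYFormAt` clauses are PROVED HERE, sorry-free, for EVERY abelian fourfold `X` and every
  `φ ≫ φ = -d` (`isCYFormAt_cyFormTwSq`): `T₀ = (𝟙 + σ^*)(⋀⁴W^*)`, `σ` = the factor swap of `X × X`, which is an involution
  ANTI-commuting with `φ × (−φ)` (the landed `Theorems.CYFormCarrier.isCYForm_fixedForm_of_antiInvolution`, `swap_anticomm`,
  `swap_comp_swap` — the anchor mechanism of STUB 3 with `E₀ ↦ X`);
* the carrier is ONE ABELIAN FOURFOLD, `Y = X` itself (`m = 4`), `T_Y = H⁴(X)` (`b₄ = 70`; rational- and pure-type-spanned by the landed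
  `top_le_span_isRationalClass` / `top_le_span_pureType`), and `γ = Σ_j b_j [Γᵗ_{g_j}]` a `ℚ`-combination of TRANSPOSED GRAPHS of the
  homomorphisms `g_j = (n𝟙 + ψ)^j ≫ m_Σ : X × X → X` (`m_Σ = pr₁ + pr₂`, `ψ = φ × (−φ)`, `n = d + 1`, `j = 0…4`);
* the rung REDUCES (kernel-checked, `corrCarrier_at_twistedSquare_of_clauses`) to the SAME THREE CLAUSE SHAPES as STUB 3 (§3) with
  `S⁴ ↦ X × X`, `S² ↦ X`:  (R1) `GraphPullbackIsCorrSq` = the GENERIC push–pull for transposed graphs (`(γ_g)_* = t_μ • g^*`,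
  `γ_g ∈ Alg⁴`) — literally the lemma the CM-point line is landing (J F3), instantiated at `X × X → X`;  (R2) `GraphSumTransportSq`
  = THE DELIGNE IDENTITY `T₀ = Π(m_Σ^* H⁴(X))`, `Π = Π₊ + Π₋ = f((n𝟙+ψ)^*)` the projector of `H⁴(A) = ⊕_a ⋀^aV₊ ⊗ ⋀^{4-a}V₋` onto
  `⋀⁴V₊ ⊕ ⋀⁴V₋` (`f ∈ ℚ[t]` the Lagrange polynomial with `f(λ_a) = [a ∈ {0,4}]`, `λ_a = (n+i√d)^a (n-i√d)^{4-a}` — five distinct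
  values for `n > √d`; `f̄ = f` because conjugation swaps `λ_a ↔ λ_{4-a}`), which holds because `σ ≫ m_Σ = m_Σ`, `σ^*Π₋ = Π₊σ^*` and
  `Π_± ∘ m_Σ^* = ⋀⁴(π_± ∘ m_Σ^*|_{H¹})` with `π₊ m_Σ^* u = pr₁^*(π₊u) + pr₂^*(π₋u) : H¹(X) ⥲ V₊(A)` — NO swap is needed in (R2)
  (`(𝟙+σ^*)Π₋m_Σ^* = (Π₋ + Π₊)m_Σ^*`); the tools are those of `Literature/…/WeilClassesTwistedSquare` (Lagrange projector as a polynomial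
  in `(x𝟙+Φ)^*`, `m^*` multiplicative, `exists_natCast_add_pow_mul_sub_pow_ne`) and of the X1 helper files;  (R3) `SquareClauseSq` = the
  square clause at `Y = X`: every rational `(4,4)`-class of `span(pr₁^*H⁴(X) ∪ pr₂^*H⁴(X)) ⊂ H⁸(X × X)` is algebraic.
* REGIME (J's T3 test, stated honestly).  For a Hodge-general `X` (`Hg = SU(2,2)`, complexified `SL₄`, `H⁴(X) = ⊕_k ⋀^kP ⊗ ⋀^{4-k}P^∨`)
  the Hodge classes of `H⁴(X) ⊠ H⁴(X)` are the `SL₄`-invariants: SEVENTEEN lines (`Σ_k dim End(H_k)`-count: `1+1` at `(k,l) = (0,4),(4,0)`,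
  `2+2` at `(1,3),(3,1)`, `3` at `(2,2)`; and `1` each at `(0,0),(4,4),(1,1),(3,3),(2,0),(0,2),(2,4),(4,2)`).  The NINE with `k + l = 4` are
  invariant under the full unitary group `U(2,2)` hence polynomials in divisor classes (FFT for `GL₄`; the four contractions
  `P_i ⊗ P^∨_j → ℂ` are `pr₁^*h, pr₂^*h` and the two `K`-components of `m_Σ^*h − pr₁^*h − pr₂^*h`) — among them the TWO WEIL LINES
  `w₊ ⊠ w₋`, `w₋ ⊠ w₊` of the twisted square, which are ALGEBRAIC IN THE TREE, unconditionally (`weilClasses_twSq_algebraic` below =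
  `Literature.…WeilClassesTwistedSquare.weilClassesOf_twistedSquare_le_algebraicClasses`, Deligne's `A₀ ⊗ E` mechanism, LNM 900 Lemma 4.5);
  the EIGHT with `k + l ≠ 4` transform under the centre `U(1) ⊂ U(2,2)` by a NON-TRIVIAL character (`det^{±1}` or `det^{±2}`) and are EXCEPTIONAL: e.g. the `(2,0)` line `h² ⊠ w` gives back
  `w` by `pr₂_*((h² ⊠ w) ∪ pr₁^*h²) = (∫_X h⁴)·w`, so (R3) at `Y = X` IMPLIES E4(X) and, conversely, follows from E4(X) + FFT + Lefschetz (1,1).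
  Hence STUB 5 is OUTSIDE the TREE-known regime (E4 of a Hodge-general fourfold is the NAMED FACT
  `Markman2025_weilClasses_algebraic_abelianFourfold` / `Markman2023_…_discOneWeilFourfold`, not a theorem; nothing of HC on `X × X` in `H⁴ ⊠ H⁴`
  beyond the two Weil lines is in tree) and INSIDE the PRINT-known regime (Markman 2025 Thm 1.2 ⇒ E4(X) ⇒ (R3) ⇒ STUB 5 via (R1)+(R2), and the
  trivial carrier works in print too) — the SAME flag «modulo print-known regime» as STUB 4, J F2(α); it is NOT a witness outside the print-known
  regime (none is expected short of (β)/(γ), J r2a).  What it buys over STUB 4: CY half PROVED (not planned); carrier abelian and single (no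
  hyperkähler sixfolds, no disjoint union, no exterior `corrAction`); transport = (R1) generic + (R2) one explicit identity — the CM-point line's
  infrastructure verbatim one object up, so (R1)/(R2) landed for STUB 3 in generic form pay here too; residue = (R3) ⟺ E4(X) exactly (the honest
  price, print-known), with 2 of its 17 lines already tree theorems.  At an `E₀`-power `X` (CM) STUB 5 falls back inside the tree-known regime of
  STUB 3 (`tate_hodgeConjectureFor_multiPowSucc`), as it must.
* ERRATUM to STUB 4's technique clause (i) (docstring of `stub_corrCarrier_at_weilFourfoldProduct`, §5; recorded here because §5 is frozen):
  «`T = T₀₄ ⊕ T₁₃ ⊕ T₂₂ ⊕ T₃₁ ⊕ T₄₀` over `ℚ`, ranks `(1,16,36,16,1)`» is NOT right for the `ℚ`-form: `(1,16,36,16,1)` are the HODGE NUMBERS of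
  `T` and the `K`-ranks of the Künneth pieces of `⋀⁴_K(W ⊕ W′)`; the CY `ℚ`-form `T ⊂ E₊ ⊕ E₋` is the graph of a `Hg`-equivariant
  `λ : E₋ ⥲ E₊` (it meets `E₊` trivially and `K`-spans), and Schur's lemma for `SL₄ × SL₄` forces `λ(E₋^{(k,4-k)}) = E₊^{(4-k,k)}`
  (`E₋^{(1,3)} ≅ P^∨ ⊗ ⋀³P′^∨`, `E₊^{(1,3)} ≅ P ⊗ ⋀³P′` are non-isomorphic, `E₊^{(3,1)} ≅ ⋀³P ⊗ P′ ≅ P^∨ ⊗ ⋀³P′^∨ ⊗ (dets)` is the match), so over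
  `ℚ` the form splits as `T = T_{⟨0,4⟩} ⊕ T_{⟨1,3⟩} ⊕ T₂₂` with ranks `(2, 32, 36)`, `T_{⟨1,3⟩}` sitting DIAGONALLY across the Künneth types
  `(1,3) ⊕ (3,1)` (Hodge numbers `(0,8,16,8,0)`) and `T_{⟨0,4⟩}` (rank 2, Hodge numbers `(0,0,2,0,0)`) inside `(0,4) ⊕ (4,0)`; `T₂₂` (rank 36, Hodge numbers `(1,8,18,8,1) ∋ T^{4,0}`,
  `T₂₂ = π₂₂(T₁(X) ⊗ T₁(X′))` for the matching pencil member) and the «abelian piece of rank 34» are UNCHANGED, so clauses (ii)–(iii) of the plan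
  stand with `T₀₄ ⊕ T₁₃ ⊕ T₃₁ ⊕ T₄₀` read as `T_{⟨0,4⟩} ⊕ T_{⟨1,3⟩}`.  (At `X′ = X̄`, §6, the same diagonal phenomenon is visible on the nose:
  `T₀ = (𝟙 + σ^*)⋀⁴(V₋ ⊕ V′₊)` pairs `⋀^kV₋ ⊗ ⋀^{4-k}V′₊` with its swap.)

HONEST FRAMING (repeated for §6). Nothing below proves STUB 5, STUB 4, X1corr, E4, E8, rung H2 or HC; the Markman named facts are NOT assumed or
used; HC_CM is HELD and untouched.  PROVED here: the CY half at every twisted square (`isCYFormAt_cyFormTwSq`, `exists_cyForm_twSq`), the Weil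
lines of the twisted square algebraic (tree citation), and the reduction of STUB 5 to (R1)+(R2)+(R3).
[cite: Deligne1982HodgeCycles, §4 Lemma 4.5 and (4.4)] [cite: Schoen1998HodgeWeilAddendum, §10] [cite: arXiv:1109.5632, §2.4.2 and §3.5 Prop. 37]
[cite: Markman2025SurveySecant, Thm. 1.2, §11.5 Step 2] [cite: Markman2023GeneralizedKummers, Theorem 1.3] [cite: vanGeemen1994HodgeAV, 4.9, Lemma 5.2, Thm. 6.12]
[cite: Fulton1998, §16.1 Prop. 16.1.1–16.1.2] [cite: MoonenZarhin1999LowDim, Cor. (3.9)] [cite: Kleiman1968, Thm. 2A9–2A11] -/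

section TwistedSquareRung

variable (X : AbelianVariety ℂ) (φ : X ⟶ X)

/-- The factor swap `σ = (pr₂, pr₁)` of `X × X` — an involution ANTI-commuting with `φ × (−φ)`. [cite: Schoen1998HodgeWeilAddendum, §10] -/
abbrev twSwap : X.prod X ⟶ X.prod X :=
  AbelianVariety.prodLift (AbelianVariety.snd X X) (AbelianVariety.fst X X)

/-- The sum map `m_Σ = pr₁ + pr₂ : X × X → X` — the structure map of the carrier `Y = X` (the `g_j` of (R2) are
`(n𝟙 + ψ)^j ≫ m_Σ`). [cite: vanGeemen1994HodgeAV, proof of Lemma 5.2] -/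
abbrev sumMap : X.prod X ⟶ X :=
  AbelianVariety.fst X X + AbelianVariety.snd X X

/-- **The explicit CY form of the twisted square**: `T₀(X, φ, d) = (𝟙 + σ^*)(⋀⁴W^*)`,
`⋀⁴W^* = weilClassesMinus (X × X) (φ × (−φ)) 2 d ⊂ H⁴`. [cite: arXiv:1109.5632, §3.5 Prop. 37] -/
abbrev cyFormTwSq (d : ℕ) : Submodule ℂ (complexBetti (X.prod X).X (2 * 2)) :=
  (weilClassesMinus (X.prod X) (prodWeilAct X X φ (-φ)) 2 d).map
    (LinearMap.id + (complexBetti.map (twSwap X).hom.hom.hom (2 * 2)).hom)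

variable {X φ}

/-- `dim (X × X) = 2·4` for a fourfold `X`. -/
theorem twSq_dim (hX : X.dim = 2 * 2) : (X.prod X).dim = 2 * 4 :=
  prodWeil_dim hX hX

/-- `(φ × (−φ))² = -d`. [cite: Schoen1998HodgeWeilAddendum, §10] -/
theorem twSqAct_comp_self {d : ℕ} (hφ : φ ≫ φ = -(d • 𝟙 X)) :
    prodWeilAct X X φ (-φ) ≫ prodWeilAct X X φ (-φ) = -(d • 𝟙 (X.prod X)) :=
  prodWeilAct_comp_self hφ (neg_comp_neg_eq hφ)

/-- `σ ≫ (φ × (−φ)) = -((φ × (−φ)) ≫ σ)` (landed: `Theorems.CYFormCarrier.swap_anticomm`, any abelian variety). -/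
theorem twSwap_anticomm : twSwap X ≫ prodWeilAct X X φ (-φ) = -(prodWeilAct X X φ (-φ) ≫ twSwap X) :=
  Summit.HodgeConjecture.HodgeConjecture.Theorems.CYFormCarrier.swap_anticomm

/-- `σ ≫ σ = 𝟙` (landed: `Theorems.CYFormCarrier.swap_comp_swap`). -/
theorem twSwap_comp_self : twSwap X ≫ twSwap X = 𝟙 (X.prod X) :=
  Summit.HodgeConjecture.HodgeConjecture.Theorems.CYFormCarrier.swap_comp_swap

/-- `σ ≫ m_Σ = m_Σ` (the sum map is symmetric) — why (R2) needs no swap: `(𝟙 + σ^*) Π₋ m_Σ^* = (Π₋ + Π₊) m_Σ^*`. [folklore] -/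
theorem twSwap_comp_sumMap : twSwap X ≫ sumMap X = sumMap X := by
  rw [Preadditive.comp_add, AbelianVariety.prodLift_fst, AbelianVariety.prodLift_snd, add_comm]

/-- **THE CY HALF OF STUB 5 IS PROVED**: for EVERY complex abelian fourfold `X`, every `φ ≫ φ = -d`, `d > 0`, the explicit
`T₀ = cyFormTwSq X φ d` satisfies the five `IsCYFormAt` clauses at the twisted square `(X × X, φ × (−φ))` (no Hodge-generality,
no CM: the anti-involution mechanism of the X1 helper files, `E₀ ↦ X`). [cite: arXiv:1109.5632, §3.5 Prop. 37] [cite: Schoen1998HodgeWeilAddendum, §10] -/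
theorem isCYFormAt_cyFormTwSq {d : ℕ} (hd : 0 < d) (hX : X.dim = 2 * 2) (hφ : φ ≫ φ = -(d • 𝟙 X)) :
    IsCYFormAt d (X.prod X) (prodWeilAct X X φ (-φ)) (cyFormTwSq X φ d) :=
  Summit.HodgeConjecture.HodgeConjecture.Theorems.CYFormCarrier.isCYForm_fixedForm_of_antiInvolution hd (twSq_dim hX)
    (twSqAct_comp_self hφ) twSwap_anticomm twSwap_comp_self

/-- The CY half of STUB 5 in X1corr's ∃-shape, for every fourfold (sorry-free). -/
theorem exists_cyForm_twSq {d : ℕ} (hd : 0 < d) (hX : X.dim = 2 * 2) (hφ : φ ≫ φ = -(d • 𝟙 X)) :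
    ∃ T : Submodule ℂ (complexBetti (X.prod X).X (2 * 2)), IsCYFormAt d (X.prod X) (prodWeilAct X X φ (-φ)) T :=
  ⟨cyFormTwSq X φ d, isCYFormAt_cyFormTwSq hd hX hφ⟩

/-- **E8 AT THE RUNG'S EIGHTFOLD IS A TREE THEOREM** (regime bookkeeping, not used by the reduction): the Weil plane
`⋀⁸W ⊕ ⋀⁸W^* ⊂ H⁸(X × X)` of the twisted square of ANY abelian fourfold with `φ² = -d` consists of algebraic classes
(`Literature.…WeilClassesTwistedSquare`: Deligne's `A₀ ⊗ E` mechanism; one algebraic class `pr₁^*α ∪ pr₂^*β` isolated by a Lagrange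
projector in `(x𝟙+Φ)^*`).  Since `(X.prod X).X = X.X ⊗ X.X` (`AbelianVariety.prod_X`, `rfl`) these are TWO of the seventeen Hodge lines
the square clause (R3) `SquareClauseSq X` quantifies over for a Hodge-general `X` (`w₊ ⊠ w₋`, `w₋ ⊠ w₊ ∈ pr₁^*H⁴(X) ∪ pr₂^*H⁴(X)`);
the eight exceptional lines (⟺ E4(X)) are not tree theorems. [cite: Deligne1982HodgeCycles, §4 Lemma 4.5] [cite: vanGeemen1994HodgeAV, 4.9] -/
theorem weilClasses_twSq_algebraic {d : ℕ} (hX : X.dim = 2 * 2) (hd : 0 < d) (hφ : φ ≫ φ = -(d • 𝟙 X)) :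
    weilClassesOf (X.prod X) (prodWeilAct X X φ (-φ)) 4 d ≤ algebraicClasses (X.X ⊗ X.X) 4 :=
  weilClassesOf_twistedSquare_le_algebraicClasses (g := 4) (by norm_num) (hX.trans (by norm_num)) hd hφ

/-! ### The three clauses at `Y = X` and the kernel-checked reduction (§3 with `S⁴ ↦ X × X`, `S² ↦ X`) -/

/-- Smoothness certificate of the twisted square in the `A.dim`-indexed form `HasCorrCarrier` uses. -/
theorem twSq_smooth : IsSmoothProjective (X.prod X).dim (X.prod X).X :=
  AbelianVariety.isSmoothProjective_holds

/-- The carrier `Y = X` is a smooth projective FOURFOLD (`m = 4`). -/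
theorem fourfold_smooth (hX : X.dim = 2 * 2) : IsSmoothProjective 4 X.X :=
  isSmoothProjective_of_dim_eq' (hX.trans (by norm_num))

variable (X) in
/-- **Clause (R1) `GraphPullbackIsCorrSq`** — push–pull for transposed graphs of homomorphisms `g : X × X → X`: algebraic classes
`γ_g ∈ Alg⁴((X × X) ⊗ X)`, independent of `μ`, with `(γ_g)_* = t_μ • g^*` on `H⁴` for ONE non-zero scalar `t_μ` per orientation family.
The generic lemma behind STUB 3's (R1) (J F3), instantiated here; size S–M. [cite: Fulton1998, §16.1 Prop. 16.1.2 (c)] -/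
def GraphPullbackIsCorrSq (hX : X.dim = 2 * 2) : Prop :=
  ∃ γg : (X.prod X ⟶ X) → complexBetti ((X.prod X).X ⊗ X.X) (2 * 4),
    (∀ g, γg g ∈ algebraicClasses ((X.prod X).X ⊗ X.X) 4) ∧
    ∀ μ : OrientationFamily, μ.HasPoincareDuality → ∃ t : ℂ, t ≠ 0 ∧ ∀ g,
      corrAction μ twSq_smooth (fourfold_smooth hX) (rfl : 2 * 2 + 2 * 4 = 2 * 2 + 2 * 4) (γg g) =
        t • (complexBetti.map g.hom.hom.hom (2 * 2)).hom

variable (X φ) in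
/-- **Clause (R2) `GraphSumTransportSq` — the Deligne identity** `Σ_j c_j g_j^* (H⁴(X)) = T₀`: finitely many homomorphisms
`g_n : X × X → X` and complex coefficients with `(Σ_n c_n g_n^*) H⁴(X) = cyFormTwSq X φ d`.  Explicit solution: `g_j = (n𝟙 + ψ)^j ≫ m_Σ`
(`j = 0…4`, `n = d + 1`), `c_j` = the coefficients of the Lagrange polynomial `f ∈ ℚ[t]` with `f((n+i√d)^a (n-i√d)^{4-a}) = [a ∈ {0,4}]`, so
that `Σ_j c_j g_j^* = (Π₊ + Π₋) ∘ m_Σ^*`, and `Π_± ∘ m_Σ^* = ⋀⁴(π_± m_Σ^*|_{H¹})` with `π₊ m_Σ^* : H¹(X) ⥲ V₊(X × X)`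
(`u ↦ pr₁^*π₊u + pr₂^*π₋u`); `(𝟙 + σ^*)Π₋ m_Σ^* = (Π₋ + Π₊) m_Σ^*` by `σ ≫ m_Σ = m_Σ`.  Size M (pure linear algebra in `⋀•H¹`).
[cite: Deligne1982HodgeCycles, §4 Lemma 4.5] [cite: arXiv:1109.5632, §3.5 Prop. 37] [cite: vanGeemen1994HodgeAV, proof of Lemma 5.2] -/
def GraphSumTransportSq (d : ℕ) : Prop :=
  ∃ (N : ℕ) (g : Fin N → (X.prod X ⟶ X)) (c : Fin N → ℂ),
    (⊤ : Submodule ℂ (complexBetti X.X (2 * 2))).map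
      (∑ n, c n • (complexBetti.map (g n).hom.hom.hom (2 * 2)).hom) = cyFormTwSq X φ d

variable (X) in
/-- **Clause (R3) `SquareClauseSq`** — the square clause of `HasCorrCarrier` at `Y = X`, `T_Y = H⁴(X)`: every rational `(4,4)`-class of
`span(pr₁^*u ∪ pr₂^*v) ⊂ H⁸(X ⊗ X)` is algebraic.  For a Hodge-general `X`: 17 Hodge lines, 9 divisor polynomials (2 of them the Weil lines of
the twisted square — tree theorems, `weilClasses_twSq_algebraic`), 8 exceptional ⟺ E4(X) — PRINT-known (Markman), NOT tree-known: THE PRICE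
of STUB 5. [cite: Markman2025SurveySecant, Thm. 1.2] [cite: Markman2023GeneralizedKummers, Theorem 1.3] [cite: MoonenZarhin1999LowDim, Cor. (3.9)] -/
def SquareClauseSq : Prop :=
  ∀ c ∈ Submodule.span ℂ {x | ∃ u ∈ (⊤ : Submodule ℂ (complexBetti X.X (2 * 2))),
      ∃ v ∈ (⊤ : Submodule ℂ (complexBetti X.X (2 * 2))),
      x = cupProduct (show 2 * 2 + 2 * 2 = 2 * 4 from rfl)
        (complexBetti.map (CartesianMonoidalCategory.fst X.X X.X) (2 * 2) u)
        (complexBetti.map (CartesianMonoidalCategory.snd X.X X.X) (2 * 2) v)},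
    IsRationalClass c → IsOfHodgeType (4 + 4) (X.X ⊗ X.X) (2 * 4) 4 4 c → c ∈ algebraicClasses (X.X ⊗ X.X) 4

variable (X φ) in
/-- The TRANSPORT clause of `HasCorrCarrier` at the twisted square for the carrier `Y = X`: an algebraic `γ ∈ Alg⁴((X × X) ⊗ X)` with
`γ_* H⁴(X) = T₀` for every `μ`. -/
def CorrTransportSq (d : ℕ) (hX : X.dim = 2 * 2) : Prop :=
  ∃ γ : complexBetti ((X.prod X).X ⊗ X.X) (2 * 4),
    γ ∈ algebraicClasses ((X.prod X).X ⊗ X.X) 4 ∧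
    ∀ μ : OrientationFamily, μ.HasPoincareDuality →
      (⊤ : Submodule ℂ (complexBetti X.X (2 * 2))).map
        (corrAction μ twSq_smooth (fourfold_smooth hX) (rfl : 2 * 2 + 2 * 4 = 2 * 2 + 2 * 4) γ) =
      cyFormTwSq X φ d

/-- **(R1) + (R2) ⇒ transport**: `γ := Σ_n c_n γ_{g_n}` is algebraic and acts as `t_μ • Σ_n c_n g_n^*`, whose image of `H⁴(X)` is `T₀`. -/
theorem corrTransportSq_of_graphs {d : ℕ} (hX : X.dim = 2 * 2) (h1 : GraphPullbackIsCorrSq X hX)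
    (h2 : GraphSumTransportSq X φ d) : CorrTransportSq X φ d hX := by
  obtain ⟨γg, hγalg, hγact⟩ := h1
  obtain ⟨N, g, c, hsum⟩ := h2
  refine ⟨∑ n, c n • γg (g n), ?_, ?_⟩
  · exact Submodule.sum_mem _ fun n _ => Submodule.smul_mem _ _ (hγalg _)
  · intro μ hμ
    obtain ⟨t, ht, hg⟩ := hγact μ hμ
    have key : corrAction μ twSq_smooth (fourfold_smooth hX) (rfl : 2 * 2 + 2 * 4 = 2 * 2 + 2 * 4)
        (∑ n, c n • γg (g n)) = t • ∑ n, c n • (complexBetti.map (g n).hom.hom.hom (2 * 2)).hom := by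
      rw [map_sum, Finset.smul_sum]
      refine Finset.sum_congr rfl fun n _ => ?_
      rw [map_smul, hg, smul_comm]
    rw [key, map_smul_top_eq _ ht, hsum]

/-- **STUB 5 from the three named clauses** (kernel-checked): `T := T₀ = cyFormTwSq` (CY half proved), `Y := X` (`m = 4`),
`T_Y := ⊤ = H⁴(X)` (`dim = 70`, rational- and pure-type-spanned), the square clause (R3), the transport clause from (R1)+(R2). -/
theorem corrCarrier_at_twistedSquare_of_clauses {d : ℕ} (hd : 0 < d) (hX : X.dim = 2 * 2) (hφ : φ ≫ φ = -(d • 𝟙 X))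
    (h1 : GraphPullbackIsCorrSq X hX) (h2 : GraphSumTransportSq X φ d) (h3 : SquareClauseSq X) :
    ∃ T : Submodule ℂ (complexBetti (X.prod X).X (2 * 2)),
      IsCYFormAt d (X.prod X) (prodWeilAct X X φ (-φ)) T ∧ HasCorrCarrier (X.prod X) T := by
  obtain ⟨γ, hγ, hγT⟩ := corrTransportSq_of_graphs hX h1 h2
  refine ⟨cyFormTwSq X φ d, isCYFormAt_cyFormTwSq hd hX hφ, 4, X.X, fourfold_smooth hX, ⊤, γ,
    Summit.HodgeConjecture.HodgeConjecture.Theorems.CYFormCarrier.finrank_top_four_of_dim_four (hX.trans (by norm_num)),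
    Summit.HodgeConjecture.HodgeConjecture.Theorems.CYFormCarrier.top_le_span_isRationalClass (fourfold_smooth hX) _,
    Summit.HodgeConjecture.HodgeConjecture.Theorems.CYFormCarrier.top_le_span_pureType (fourfold_smooth hX) _,
    h3, hγ, ?_⟩
  intro μ hμ
  exact hγT μ hμ

/-- **STUB 5 — THE F2(α′) RUNG `stub_corrCarrier_at_weilFourfoldTwistedSquare` (BC5 / tribunal T3, «modulo print-known regime»)**: for
every `d > 0` and every Hodge-general split `ℚ(√-d)`-Weil abelian FOURFOLD `(X, φ)` (`dim = 2·2`, `φ² = -d`, hyperbolic for the symmetrised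
hyperplane class, `Hg = SU(2,2)` — X1corr's binders at `n = 2`, one factor of STUB 4), the ∃-conclusion of the crux X1corr VERBATIM at the
TWISTED SQUARE `(A, ψ) = (X × X, φ × (−φ))` (`twSq_dim`, `twSqAct_comp_self`): a CY form WITH A CORRESPONDENCE CARRIER.  = STUB 4 at the pair
`(X, φ), (X, −φ)` up to the `−φ`-binders.  The CY half is PROVED (`exists_cyForm_twSq`); the prover's entry point is
`stub_corrCarrier_at_weilFourfoldTwistedSquare_of_clauses` ((R1) generic push–pull, (R2) the Deligne identity, (R3) the square clause at
`Y = X` ⟺ E4(X): print-known — Markman 2025 — NOT tree-known; the Hodge-generality binders are not used by the reduction and only keep the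
statement inside the print-known regime).  Why it might fail AS A PLAN: (R2) needs the eigen-decomposition `H⁴(X × X) = ⊕_a ⋀^aV₊ ⊗ ⋀^{4-a}V₋`
and the injectivity of `⋀⁴(π₊ m_Σ^*)` in the tree's `hasExteriorCohomologyH1` language (typed for one class in `WeilClassesTwistedSquare`, not
for a 70-dimensional image); (R3) is E4-hard for Hodge-general `X` (no claim to close it).  Beside the crux like STUB 3/4 (X1corr would give it
only under `HasHodgeGroupSU (X × X) ψ 4 …`, false: `Hg(X × X̄) = Hg(X) = SU(2,2)`).
[cite: Deligne1982HodgeCycles, §4 Lemma 4.5] [cite: arXiv:1109.5632, §2.4.2 and §3.5 Prop. 37] [cite: Schoen1998HodgeWeilAddendum, §10]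
[cite: Markman2025SurveySecant, Thm. 1.2 and §11.5 Step 2] [cite: Fulton1998, §16.1 Prop. 16.1.2] [cite: vanGeemen1994HodgeAV, Lemma 5.2 and Thm. 6.12] -/
theorem stub_corrCarrier_at_weilFourfoldTwistedSquare :
    ∀ d : ℕ, 0 < d → ∀ (X : AbelianVariety ℂ) (φ : X ⟶ X) (e : ProjectiveEmbedding X.X) (a : complexBetti (projectiveSpace e.n ℂ) 2),
      X.dim = 2 * 2 → φ ≫ φ = -(d • 𝟙 X) → IsRationalClass a → a ≠ 0 →
      IsHyperbolicWeilType X φ 2 (symH d φ e a) →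
      Literature.AlgebraicGeometry.VanGeemen1994.HasHodgeGroupSU X φ 2 d (symH d φ e a) →
      ∃ T : Submodule ℂ (complexBetti (X.prod X).X (2 * 2)),
        IsCYFormAt d (X.prod X) (prodWeilAct X X φ (-φ)) T ∧ HasCorrCarrier (X.prod X) T := by
  sorry

/-- **`stub_corrCarrier_at_weilFourfoldTwistedSquare_of_clauses`** — STUB 5 for all `d`, all `(X, φ)`, from the three clauses supplied
pointwise (the prover's entry point; the Hodge-generality binders are simply dropped). -/
theorem stub_corrCarrier_at_weilFourfoldTwistedSquare_of_clauses
    (h : ∀ d : ℕ, 0 < d → ∀ (X : AbelianVariety ℂ) (φ : X ⟶ X) (hX : X.dim = 2 * 2), φ ≫ φ = -(d • 𝟙 X) →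
      GraphPullbackIsCorrSq X hX ∧ GraphSumTransportSq X φ d ∧ SquareClauseSq X) :
    ∀ d : ℕ, 0 < d → ∀ (X : AbelianVariety ℂ) (φ : X ⟶ X) (e : ProjectiveEmbedding X.X) (a : complexBetti (projectiveSpace e.n ℂ) 2),
      X.dim = 2 * 2 → φ ≫ φ = -(d • 𝟙 X) → IsRationalClass a → a ≠ 0 →
      IsHyperbolicWeilType X φ 2 (symH d φ e a) →
      Literature.AlgebraicGeometry.VanGeemen1994.HasHodgeGroupSU X φ 2 d (symH d φ e a) →
      ∃ T : Submodule ℂ (complexBetti (X.prod X).X (2 * 2)),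
        IsCYFormAt d (X.prod X) (prodWeilAct X X φ (-φ)) T ∧ HasCorrCarrier (X.prod X) T := by
  intro d hd X φ e a hX hφ _ _ _ _
  obtain ⟨h1, h2, h3⟩ := h d hd X φ hX hφ
  exact corrCarrier_at_twistedSquare_of_clauses hd hX hφ h1 h2 h3

/-- **STUB 5 packaged with the twisted square's Weil-type certificate** (`dim = 2·4`, `ψ² = -d`) — the companion of
`product_eightfold_with_corrCarrier_of_stub` on the anti-diagonal `X′ = X̄`. -/
theorem twistedSquare_eightfold_with_corrCarrier_of_stub
    (h : ∀ d : ℕ, 0 < d → ∀ (X : AbelianVariety ℂ) (φ : X ⟶ X) (e : ProjectiveEmbedding X.X) (a : complexBetti (projectiveSpace e.n ℂ) 2),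
      X.dim = 2 * 2 → φ ≫ φ = -(d • 𝟙 X) → IsRationalClass a → a ≠ 0 →
      IsHyperbolicWeilType X φ 2 (symH d φ e a) →
      Literature.AlgebraicGeometry.VanGeemen1994.HasHodgeGroupSU X φ 2 d (symH d φ e a) →
      ∃ T : Submodule ℂ (complexBetti (X.prod X).X (2 * 2)),
        IsCYFormAt d (X.prod X) (prodWeilAct X X φ (-φ)) T ∧ HasCorrCarrier (X.prod X) T)
    {d : ℕ} (hd : 0 < d) (hX : X.dim = 2 * 2) (hφ : φ ≫ φ = -(d • 𝟙 X))
    (e : ProjectiveEmbedding X.X) {a : complexBetti (projectiveSpace e.n ℂ) 2} (ha : IsRationalClass a) (ha0 : a ≠ 0)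
    (hhyp : IsHyperbolicWeilType X φ 2 (symH d φ e a))
    (hSU : Literature.AlgebraicGeometry.VanGeemen1994.HasHodgeGroupSU X φ 2 d (symH d φ e a)) :
    (X.prod X).dim = 2 * 4 ∧ prodWeilAct X X φ (-φ) ≫ prodWeilAct X X φ (-φ) = -(d • 𝟙 (X.prod X)) ∧
      ∃ T : Submodule ℂ (complexBetti (X.prod X).X (2 * 2)),
        IsCYFormAt d (X.prod X) (prodWeilAct X X φ (-φ)) T ∧ HasCorrCarrier (X.prod X) T :=
  ⟨twSq_dim hX, twSqAct_comp_self hφ, h d hd X φ e a hX hφ ha ha0 hhyp hSU⟩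

/-- STUB 5 IS X1corr's ∃-conclusion at the twisted square (definitional, cf. `productRung_eq_X1corr_conclusion_at_product`). -/
theorem twistedSquareRung_eq_X1corr_conclusion_at_twSq (d : ℕ) :
    (∃ T : Submodule ℂ (complexBetti (X.prod X).X (2 * 2)),
        IsCYFormAt d (X.prod X) (prodWeilAct X X φ (-φ)) T ∧ HasCorrCarrier (X.prod X) T) ↔
      (∃ T : Submodule ℂ (complexBetti (X.prod X).X (2 * 2)),
        IsCYFormAt d (X.prod X) (AbelianVariety.prodLift (AbelianVariety.fst X X ≫ φ) (AbelianVariety.snd X X ≫ (-φ))) T ∧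
          HasCorrCarrier (X.prod X) T) :=
  Iff.rfl

end TwistedSquareRung


end Summit.HodgeConjecture.HodgeConjecture.Cruxes.CYFormCorrCarrierEight.Birth

end
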